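import Literature.Barriers.FinalStateConjecture.KleinGordonMatching
import Literature.Barriers.FinalStateConjecture.KleinGordonModeConstructionProofs
import Literature.Barriers.FinalStateConjecture.KleinGordonAngularModes
import Literature.Barriers.FinalStateConjecture.KleinGordonRadialCurrent
import Literature.Barriers.FinalStateConjecture.KleinGordonHorizonFlux
import Literature.Barriers.FinalStateConjecture.KleinGordonAngularSuperradiantInput
import Literature.Analysis.SpecialFunctions.SpheroidalHarmonicBranches
import Literature.Analysis.Complex.SimpleZeroPerturbation
import Literature.Analysis.ODE.SecondOrderZeros
import HarnessLib

/-!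
# Unstable Klein–Gordon modes on sub-extremal Kerr and the proofs of
# `ShlapentokhRothman2014_separatedMode` and `KleinGordonSuperradiantInstability`
# (Shlapentokh-Rothman, CMP 329 (2014), Thms. 1.1–1.2)

Topic `Literature/Barriers/FinalStateConjecture` (namespace `Literature.Barriers.FinalStateConjecture`).
This file discharges the named facts `ShlapentokhRothman2014_separatedMode`
(`ShlapentokhRothman2014_separatedMode_holds`: Thm. 1.2 in the printed separated variables, read at
one small `ε > 0`, with its superradiance clause), hence `ShlapentokhRothman2014_unstableModeProfile`
(`ShlapentokhRothman2014_unstableModeProfile_holds`, through the proved reduction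
`…unstableModeProfile.of_separatedMode`) and `KleinGordonSuperradiantInstability`
(`KleinGordonSuperradiantInstability_holds`, Thm. 1.1), following Shlapentokh-Rothman's construction
of exponentially growing modes bifurcating from a REAL mode at the superradiant threshold
`ω₀ = am/(2Mr₊)` (loc. cit. §4), in an ODE rendering that replaces the variational and
implicit-function steps of the paper by Sturm theory and a one-complex-variable Newton argument:

* **radial back-conversion** (`mdR`, `mdR_ode`, `isRadialSolution_mdR`, `mdF`,
  `mdR_eq_phase_mul_mdF`, `contDiffOn_mdF`, `decay_mdR`): the horizon-regular solution `y` of the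
  normal form (`KleinGordonRadialLiouville`) gives `R = y/√Δ` solving (2.2), of the horizon form
  `e^{−i(ωt̄ − mφ̄)} f` with `f = e^{iωr}u` smooth across `r₊` (`ω t̄ − m φ̄ = ω r − θ`,
  `starTime_sub_starAngle`), decaying when `y` does;
* **mode data from a zero of the matching function** (`separated_data_of_zero`) and the glue
  `KleinGordonSuperradiantInstability.of_separated_data` re-running the proved reductions of
  `KleinGordonModeConstruction(Proofs)` / `KleinGordonSuperradiantInstabilityProofs` (Carter
  separation on the leaf, decay of the profile, energy growth), which never use the superradiance
  inequality of the printed Theorem 1.2;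
* **superradiance of the constructed modes** (`superradiant_mdR_of_zero`): loc. cit. Prop. 4.6 as
  proved in `KleinGordonRadialCurrent` (`superradiant_of_isRadialSolution`, the monotone microlocal
  current `Im(Δ R' ω̄ R̄)`), fed with the horizon flux limit of `KleinGordonHorizonFlux`
  (`tendsto_horizonFlux_of_horizonForm`, from the horizon form `e^{−i(ωt̄ − mφ̄)} f`) and the angular
  input Prop. B.2 of `KleinGordonAngularSuperradiantInput` (`im_angular_mul_conj_neg`, valid under
  `a²|ω|² ≤ |m|(|m|+1)`; here `|ω − ω₀| ≤ |ω₀|/2` and `a²ω₀² = m²(a²/2Mr₊)² < m²/4` since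
  `2Mr₊ = r₊² + a² > 2a²`);
* **threshold structure** (`matchA_thrP_eq`, `matchA_thrP_eq_zero_of_decay`, `wronskian_thr_neg`):
  at `ω₀` and real `(Λ, σ)`, `𝔞 = u Φ₀ W(ρ, z)` with real solutions `ρ > 0` (recessive) and
  `z = thrZ` (horizon-regular); the bound state of `KleinGordonRealModes` is a zero of `𝔞`, and
  below it (where `z` has a first zero far out) `W(ρ, z) < 0`;
* **simplicity of the threshold zero** (`im_deriv_matchA_threshold`): differentiating the current
  identity of `KleinGordonMatching` along the real axis gives
  `im(∂_ω𝔞 · conj(y_rec y)) = −2Mr₊‖y_rec‖² ≠ 0` (the mechanism of loc. cit. Prop. 4.6);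
* **the level and the branch** (`LamOf`, `thrZ_pos_of_large`, `exists_local_complex_branch`,
  `curveP`): the angular eigenvalue along a real-analytic branch of `SpheroidalHarmonicBranches`
  as a function of the mass, its holomorphic extension, and the absence of zeros for large mass
  (`V ≥ 0`), which at a high angular level `l` pins the bound-state mass within any `δ` of `|ω₀|`;
* **the modes** (`exists_superradiant_mode_data`, `exists_mode_data`): shooting in `μ` for the
  bound state, persistence of the simple zero of `ω ↦ 𝔞(ω, Λ(ω, μ), μ²)` under the change of `μ`
  (`SimpleZeroPerturbation`), `Im ω(μ) > 0` for `μ` slightly below the bound-state mass from the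
  sign `W(ρ, z) < 0` and the first-order location of the perturbed zero, and superradiance
  `2Mr₊|ω(μ)| < |am|` of the resulting mode.

Everything is proved; no new named facts.

## References
* Y. Shlapentokh-Rothman, *Exponentially growing finite energy solutions for the Klein–Gordon
  equation on sub-extremal Kerr spacetimes*, Comm. Math. Phys. 329 (2014) 859–891
  (arXiv:1302.3448), Thm. 1.1, Thm. 1.2, §2, §4 (Props. 4.1–4.2, Lemma 4.3, §4.3, Prop. 4.6),
  App. B–C. Key `ShlapentokhRothman2014KleinGordon`.
* P. Hartman, *Ordinary Differential Equations*, SIAM Classics 38 (2002), Ch. XI §6. Key `Hartman2002`.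
-/

noncomputable section

open Set Filter Metric
open scoped Topology ComplexConjugate ContDiff


namespace Literature.Barriers.FinalStateConjecture

open Literature.Geometry.Lorentzian Literature.Analysis.ODE Literature.Analysis.SpecialFunctions
  Literature.Analysis.Complex

/-! ### From a horizon-regular solution of the normal form back to the radial ODE (2.2) -/

section RadialBack

variable {M a : ℝ} {m : ℤ}

/-- `x ↦ (x : ℂ)` is smooth (for `fun_prop`). [folklore] -/
@[fun_prop] theorem contDiff_ofReal_fsc {n : WithTop ℕ∞} : ContDiff ℝ n (fun x : ℝ ↦ (x : ℂ)) := Complex.ofRealCLM.contDiff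

/-- Our potential is SR's `V_μ`: `radPot (w, Λ, μ²) = kgRadialPotential w Λ μ`. [cite: ShlapentokhRothman2014KleinGordon, §2 (2.2)] -/
theorem radPot_eq_kgRadialPotential (w Λ : ℂ) (μ r : ℝ) :
    radPot M a m (w, Λ, ((μ ^ 2 : ℝ) : ℂ)) r = kgRadialPotential M a w m Λ μ r := by
  simp only [radPot, kgRadialPotential]
  push_cast
  ring

/-- `Q(·; p)` is smooth on `(r₊, ∞)`. [folklore] -/
theorem contDiffOn_radQ (h : |a| ≤ M) (p : ℂ × ℂ × ℂ) : ContDiffOn ℝ ∞ (radQ M a m p) (Ioi (Kerr.rPlus M a)) := by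
  have hΔ : ∀ r ∈ Ioi (Kerr.rPlus M a), Kerr.delta M a r ^ 2 ≠ 0 := fun r hr ↦ pow_ne_zero 2 (Kerr.delta_pos h hr).ne'
  have hpot : ContDiff ℝ ∞ fun r ↦ radPot M a m p r := by
    unfold radPot Kerr.delta; fun_prop
  have hinv : ContDiffOn ℝ ∞ (fun r ↦ (((Kerr.delta M a r ^ 2)⁻¹ : ℝ) : ℂ)) (Ioi (Kerr.rPlus M a)) := by
    refine Complex.ofRealCLM.contDiff.comp_contDiffOn (ContDiffOn.inv ?_ hΔ)
    exact (by unfold Kerr.delta; fun_prop : ContDiff ℝ ∞ fun r ↦ Kerr.delta M a r ^ 2).contDiffOn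
  have heq : ∀ r ∈ Ioi (Kerr.rPlus M a), radQ M a m p r =
      (radPot M a m p r - ((horD M a ^ 2 / 4 : ℝ) : ℂ)) * (((Kerr.delta M a r ^ 2)⁻¹ : ℝ) : ℂ) := by
    intro r hr; rw [radQ, div_eq_mul_inv, Complex.ofReal_inv]
  exact ((hpot.contDiffOn.sub contDiffOn_const).mul hinv).congr heq

/-- The horizon-regular pair `(y, y')` is smooth on `(r₊, ∞)`. [folklore] -/
theorem contDiffOn_radY (h : |a| ≤ M) (p : ℂ × ℂ × ℂ) :
    ContDiffOn ℝ ∞ (radY M a m p) (Ioi (Kerr.rPlus M a)) ∧ ContDiffOn ℝ ∞ (radY₁ M a m p) (Ioi (Kerr.rPlus M a)) :=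
  (isSol2_radY (m := m) h p).contDiffOn (contDiffOn_radQ h p)

variable (M a m) in
/-- **The radial function** `R = y/√Δ` of the mode (SR's `R`), on `(r₊, ∞)`.
[cite: ShlapentokhRothman2014KleinGordon, §2 (2.2)] -/
def mdR (p : ℂ × ℂ × ℂ) (r : ℝ) : ℂ := radY M a m p r / ((Real.sqrt (Kerr.delta M a r) : ℝ) : ℂ)

variable (M a m) in
/-- The flux `Δ R' = y' √Δ − y (√Δ)'`. [folklore] -/
def mdFlux (p : ℂ × ℂ × ℂ) (r : ℝ) : ℂ :=
  radY₁ M a m p r * ((sqrtDelta M a r : ℝ) : ℂ) - radY M a m p r * ((sqrtDelta₁ M a r : ℝ) : ℂ)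

variable (M a m) in
/-- `R' = (Δ R')/Δ`. [folklore] -/
def mdR₁ (p : ℂ × ℂ × ℂ) (r : ℝ) : ℂ := mdFlux M a m p r / (Kerr.delta M a r : ℂ)

/-- `R' = mdR₁` on `(r₊, ∞)`. [folklore] -/
theorem hasDerivAt_mdR (h : Kerr.IsSubextremal M a) (p : ℂ × ℂ × ℂ) {r : ℝ} (hr : Kerr.rPlus M a < r) :
    HasDerivAt (mdR M a m p) (mdR₁ M a m p r) r := by
  obtain ⟨hS, hS2⟩ := sqrtDelta_pos h.le hr
  have hSd := (hasDerivAt_sqrtDelta h.le hr).ofReal_comp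
  have hy := (isSol2_radY (m := m) h.le p).hasDerivAt r hr
  have hS0 : ((sqrtDelta M a r : ℝ) : ℂ) ≠ 0 := by exact_mod_cast hS.ne'
  have h1 := hy.div hSd hS0
  have hΔ : (Kerr.delta M a r : ℂ) = ((sqrtDelta M a r : ℝ) : ℂ) ^ 2 := by rw [← Complex.ofReal_pow, hS2]
  show HasDerivAt (fun s ↦ radY M a m p s / ((sqrtDelta M a s : ℝ) : ℂ)) (mdR₁ M a m p r) r
  refine h1.congr_deriv ?_
  rw [mdR₁, mdFlux, hΔ]

/-- **The flux equation** `(Δ R')' = (Q − q₀) √Δ y` on `(r₊, ∞)`. [folklore] -/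
theorem hasDerivAt_mdFlux (h : Kerr.IsSubextremal M a) (p : ℂ × ℂ × ℂ) {r : ℝ} (hr : Kerr.rPlus M a < r) :
    HasDerivAt (mdFlux M a m p)
      ((radQ M a m p r - ((grQ0 M a r : ℝ) : ℂ)) * ((sqrtDelta M a r : ℝ) : ℂ) * radY M a m p r) r := by
  have hsol := isSol2_radY (m := m) h.le p
  have hy := hsol.hasDerivAt r hr
  have hy₁ := hsol.hasDerivAt_deriv r hr
  have hs := isSol2_sqrtDelta h
  have hS := (hs.hasDerivAt r hr).ofReal_comp
  have hS₁ := (hs.hasDerivAt_deriv r hr).ofReal_comp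
  have h1 := (hy₁.mul hS).sub (hy.mul hS₁)
  refine h1.congr_deriv ?_
  push_cast
  ring

/-- **`R` solves the radial ODE (2.2)** in the `deriv` form of `IsRadialSolution`:
`Δ (Δ R')' = V R` on `(r₊, ∞)`. [cite: ShlapentokhRothman2014KleinGordon, §2 (2.2)] -/
theorem mdR_ode (h : Kerr.IsSubextremal M a) (p : ℂ × ℂ × ℂ) {r : ℝ} (hr : Kerr.rPlus M a < r) :
    ((Kerr.delta M a r : ℝ) : ℂ) * deriv (fun s ↦ ((Kerr.delta M a s : ℝ) : ℂ) * deriv (mdR M a m p) s) r =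
      radPot M a m p r * mdR M a m p r := by
  have hΔ := Kerr.delta_pos h.le hr
  obtain ⟨hS, hS2⟩ := sqrtDelta_pos h.le hr
  -- `Δ · deriv R = flux` near `r`
  have hev : (fun s ↦ ((Kerr.delta M a s : ℝ) : ℂ) * deriv (mdR M a m p) s) =ᶠ[𝓝 r] mdFlux M a m p := by
    filter_upwards [Ioi_mem_nhds hr] with s hs
    have hΔs := Kerr.delta_pos h.le hs
    rw [(hasDerivAt_mdR h p hs).deriv, mdR₁, mul_div_cancel₀]
    exact_mod_cast hΔs.ne'
  rw [hev.deriv_eq, (hasDerivAt_mdFlux h p hr).deriv]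
  -- algebra: `Δ (Q − q₀) S y = V · (y/S)`
  have hS0 : ((sqrtDelta M a r : ℝ) : ℂ) ≠ 0 := by exact_mod_cast hS.ne'
  have hΔ0 : (Kerr.delta M a r : ℂ) ≠ 0 := by exact_mod_cast hΔ.ne'
  have hSc : ((sqrtDelta M a r : ℝ) : ℂ) ^ 2 = (Kerr.delta M a r : ℂ) := by rw [← Complex.ofReal_pow, hS2]
  have hQ : radQ M a m p r * (Kerr.delta M a r : ℂ) ^ 2 = radPot M a m p r - ((horD M a ^ 2 / 4 : ℝ) : ℂ) := by
    rw [radQ]; push_cast; field_simp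
  have hq0 : ((grQ0 M a r : ℝ) : ℂ) * (Kerr.delta M a r : ℂ) ^ 2 = -((horD M a ^ 2 / 4 : ℝ) : ℂ) := by
    rw [grQ0]; push_cast; field_simp
  rw [mdR]
  simp only [sqrtDelta] at hS0 hSc ⊢
  rw [← hSc] at hQ hq0 ⊢
  rw [← mul_div_assoc, eq_div_iff hS0]
  linear_combination radY M a m p r * (hQ - hq0)

/-- `R` is smooth on `(r₊, ∞)`. [folklore] -/
theorem contDiffOn_mdR (h : Kerr.IsSubextremal M a) (p : ℂ × ℂ × ℂ) : ContDiffOn ℝ ∞ (mdR M a m p) (Ioi (Kerr.rPlus M a)) := by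
  have hΔ : ∀ r ∈ Ioi (Kerr.rPlus M a), Kerr.delta M a r ≠ 0 := fun r hr ↦ (Kerr.delta_pos h.le hr).ne'
  have hs : ContDiffOn ℝ ∞ (fun r ↦ Real.sqrt (Kerr.delta M a r)) (Ioi (Kerr.rPlus M a)) :=
    (by unfold Kerr.delta; fun_prop : ContDiff ℝ ∞ fun r ↦ Kerr.delta M a r).contDiffOn.sqrt hΔ
  have hs0 : ∀ r ∈ Ioi (Kerr.rPlus M a), Real.sqrt (Kerr.delta M a r) ≠ 0 := fun r hr ↦
    (Real.sqrt_pos.2 (Kerr.delta_pos h.le hr)).ne'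
  have hinv : ContDiffOn ℝ ∞ (fun r ↦ (((Real.sqrt (Kerr.delta M a r))⁻¹ : ℝ) : ℂ)) (Ioi (Kerr.rPlus M a)) :=
    Complex.ofRealCLM.contDiff.comp_contDiffOn (hs.inv hs0)
  have heq : ∀ r ∈ Ioi (Kerr.rPlus M a), mdR M a m p r = radY M a m p r * (((Real.sqrt (Kerr.delta M a r))⁻¹ : ℝ) : ℂ) := by
    intro r hr; rw [mdR, div_eq_mul_inv, Complex.ofReal_inv]
  exact ((contDiffOn_radY h.le p).1.mul hinv).congr heq

/-- **`R = y/√Δ` is a radial solution in the sense of `IsRadialSolution`** (for every parameter,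
`p = (w, Λ, μ²)`). [cite: ShlapentokhRothman2014KleinGordon, §2 (2.2)] -/
theorem isRadialSolution_mdR (h : Kerr.IsSubextremal M a) (w Λ : ℂ) (μ : ℝ) :
    IsRadialSolution M a w m Λ μ (mdR M a m (w, Λ, ((μ ^ 2 : ℝ) : ℂ))) :=
  ⟨contDiffOn_mdR h _, fun r hr ↦ by rw [mdR_ode h _ hr, radPot_eq_kgRadialPotential]⟩

/-! ### The horizon form `R = e^{−i(ω t̄ − m φ̄)} f` with `f` smooth across `r₊` -/

/-- `ω t̄(r) − m φ̄(r) = ω r − θ(r; ω)`. [cite: ShlapentokhRothman2014KleinGordon, §1.2.1 and §2 (2.3)] -/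
theorem starTime_sub_starAngle (w : ℂ) (r : ℝ) :
    w * ((Kerr.starTime M a r : ℝ) : ℂ) - (m : ℂ) * ((Kerr.starAngle M a r : ℝ) : ℂ) = w * r - radTheta M a m w r := by
  simp only [Kerr.starTime, Kerr.starAngle, radTheta, horBeta, horD]
  push_cast
  ring

/-- **The leaf phase is `e^{−iωr} Φ`**: `e^{−i(ω t̄ − m φ̄)} = e^{−iωr} · Φ(r; ω)`. [folklore] -/
theorem exp_starPhase_eq (w : ℂ) (r : ℝ) :
    Complex.exp (-(Complex.I * (w * ((Kerr.starTime M a r : ℝ) : ℂ) - (m : ℂ) * ((Kerr.starAngle M a r : ℝ) : ℂ)))) =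
      Complex.exp (-(Complex.I * w * r)) * radPhase M a m w r := by
  rw [starTime_sub_starAngle, radPhase, ← Complex.exp_add]
  congr 1; ring

/-- Near `r₊`, `R = Φ u`. [folklore] -/
theorem mdR_eq_loc (h : Kerr.IsSubextremal M a) {R : ℝ} (hR : 0 ≤ R) {p : ℂ × ℂ × ℂ} (hp : p ∈ horGood M a)
    (hpR : p ∈ horBoxClosed R) {r : ℝ} (hr : r ∈ Ioo (Kerr.rPlus M a) (Kerr.rPlus M a + horRho M a R / 2)) :
    mdR M a m p r = radPhase M a m p.1 r * horU M a m p r := by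
  have hS0 : ((Real.sqrt (Kerr.delta M a r) : ℝ) : ℂ) ≠ 0 := by
    exact_mod_cast (Real.sqrt_pos.2 (Kerr.delta_pos h.le hr.1)).ne'
  rw [mdR, (radY_eq_loc (m := m) h hR hp hpR hr).1, radG]
  field_simp

variable (M a m) in
/-- **The smooth horizon function** `f`: `e^{iωr} u` near (and across) `r₊`, `e^{i(ω t̄ − mφ̄)} R`
farther out. [cite: ShlapentokhRothman2014KleinGordon, §2 (2.3)] -/
def mdF (ρ : ℝ) (p : ℂ × ℂ × ℂ) (r : ℝ) : ℂ :=
  if r < Kerr.rPlus M a + ρ / 4 then Complex.exp (Complex.I * p.1 * r) * horU M a m p r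
  else Complex.exp (Complex.I * (p.1 * ((Kerr.starTime M a r : ℝ) : ℂ) - (m : ℂ) * ((Kerr.starAngle M a r : ℝ) : ℂ))) *
    mdR M a m p r

/-- **`R = e^{−i(ω t̄ − mφ̄)} f` on `(r₊, ∞)`.** [cite: ShlapentokhRothman2014KleinGordon, §2 (2.3)] -/
theorem mdR_eq_phase_mul_mdF (h : Kerr.IsSubextremal M a) {R : ℝ} (hR : 0 ≤ R) {p : ℂ × ℂ × ℂ} (hp : p ∈ horGood M a)
    (hpR : p ∈ horBoxClosed R) {r : ℝ} (hr : Kerr.rPlus M a < r) :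
    mdR M a m p r = Complex.exp (-(Complex.I * (p.1 * ((Kerr.starTime M a r : ℝ) : ℂ) -
      (m : ℂ) * ((Kerr.starAngle M a r : ℝ) : ℂ)))) * mdF M a m (horRho M a R) p r := by
  have hρ := horRho_pos h hR
  unfold mdF
  split_ifs with hlt
  · rw [mdR_eq_loc h hR hp hpR ⟨hr, by linarith⟩, exp_starPhase_eq]
    rw [show Complex.exp (-(Complex.I * p.1 * r)) * radPhase M a m p.1 r * (Complex.exp (Complex.I * p.1 * r) * horU M a m p r) =
      (Complex.exp (-(Complex.I * p.1 * r)) * Complex.exp (Complex.I * p.1 * r)) * (radPhase M a m p.1 r * horU M a m p r) by ring,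
      ← Complex.exp_add, neg_add_cancel, Complex.exp_zero, one_mul]
  · rw [← mul_assoc, ← Complex.exp_add, neg_add_cancel, Complex.exp_zero, one_mul]

/-- `u` is real-smooth near `r₊` (both sides): `r ↦ u(r; p)` is `C^∞` on `(r₊ − ρ/2, r₊ + ρ/2)`.
[cite: ShlapentokhRothman2014KleinGordon, App. C §9.1] -/
theorem contDiffOn_horU (h : Kerr.IsSubextremal M a) {R : ℝ} (hR : 0 ≤ R) {p : ℂ × ℂ × ℂ} (hp : p ∈ horGood M a)
    (hpR : p ∈ horBoxClosed R) :
    ContDiffOn ℝ ∞ (horU M a m p) (Ioo (Kerr.rPlus M a - horRho M a R / 2) (Kerr.rPlus M a + horRho M a R / 2)) := by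
  have hd : DifferentiableOn ℂ (horFun M a m p) (ball 0 (horRho M a R / 2)) := fun x hx ↦
    (hasDerivAt_horFun h m hR hp hpR (by simpa using hx)).differentiableAt.differentiableWithinAt
  have hc : ContDiffOn ℂ ∞ (horFun M a m p) (ball 0 (horRho M a R / 2)) := hd.contDiffOn isOpen_ball
  have hcR : ContDiffOn ℝ ∞ (horFun M a m p) (ball 0 (horRho M a R / 2)) := hc.restrict_scalars ℝ
  have hlin : ContDiff ℝ ∞ (fun r : ℝ ↦ (r : ℂ) - Kerr.rPlus M a) := by fun_prop
  refine hcR.comp hlin.contDiffOn fun r hr ↦ ?_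
  simp only [mem_ball, dist_zero_right]
  rw [← Complex.ofReal_sub, Complex.norm_real, Real.norm_eq_abs, abs_lt]
  exact ⟨by linarith [hr.1], by linarith [hr.2]⟩

/-- **`f` is smooth on `(r₊ − ρ/4, ∞)`.** [cite: ShlapentokhRothman2014KleinGordon, §2 (2.3)] -/
theorem contDiffOn_mdF (h : Kerr.IsSubextremal M a) {R : ℝ} (hR : 0 ≤ R) {p : ℂ × ℂ × ℂ} (hp : p ∈ horGood M a)
    (hpR : p ∈ horBoxClosed R) :
    ContDiffOn ℝ ∞ (mdF M a m (horRho M a R) p) (Ioi (Kerr.rPlus M a - horRho M a R / 4)) := by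
  have hρ := horRho_pos h hR
  set ρ := horRho M a R with hρ_def
  -- the two branches
  set f₁ : ℝ → ℂ := fun r ↦ Complex.exp (Complex.I * p.1 * r) * horU M a m p r with hf₁
  set f₂ : ℝ → ℂ := fun r ↦ Complex.exp (Complex.I * (p.1 * ((Kerr.starTime M a r : ℝ) : ℂ) -
    (m : ℂ) * ((Kerr.starAngle M a r : ℝ) : ℂ))) * mdR M a m p r with hf₂
  have h₁ : ContDiffOn ℝ ∞ f₁ (Ioo (Kerr.rPlus M a - ρ / 2) (Kerr.rPlus M a + ρ / 2)) :=
    ((by fun_prop : ContDiff ℝ ∞ fun r : ℝ ↦ Complex.exp (Complex.I * p.1 * r)).contDiffOn).mul (contDiffOn_horU h hR hp hpR)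
  have h₂ : ContDiffOn ℝ ∞ f₂ (Ioi (Kerr.rPlus M a)) := by
    have hd : 0 < Kerr.rPlus M a - Kerr.rMinus M a := sub_pos.2 h.rMinus_lt_rPlus
    have hlog1 : ContDiffOn ℝ ∞ (fun r : ℝ ↦ Real.log (r - Kerr.rPlus M a)) (Ioi (Kerr.rPlus M a)) :=
      contDiffOn_id.sub contDiffOn_const |>.log fun r hr ↦ (sub_pos.2 hr).ne'
    have hlog2 : ContDiffOn ℝ ∞ (fun r : ℝ ↦ Real.log (r - Kerr.rMinus M a)) (Ioi (Kerr.rPlus M a)) :=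
      contDiffOn_id.sub contDiffOn_const |>.log fun r hr ↦ (sub_pos.2 (h.rMinus_lt_rPlus.trans (mem_Ioi.1 hr))).ne'
    have hT : ContDiffOn ℝ ∞ (fun r ↦ ((Kerr.starTime M a r : ℝ) : ℂ)) (Ioi (Kerr.rPlus M a)) := by
      refine Complex.ofRealCLM.contDiff.comp_contDiffOn ?_
      exact ((contDiffOn_id.add (contDiffOn_const.mul hlog1)).sub (contDiffOn_const.mul hlog2))
    have hA : ContDiffOn ℝ ∞ (fun r ↦ ((Kerr.starAngle M a r : ℝ) : ℂ)) (Ioi (Kerr.rPlus M a)) := by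
      refine Complex.ofRealCLM.contDiff.comp_contDiffOn ?_
      exact contDiffOn_const.mul (hlog1.sub hlog2)
    have hph : ContDiffOn ℝ ∞ (fun r ↦ Complex.exp (Complex.I * (p.1 * ((Kerr.starTime M a r : ℝ) : ℂ) -
        (m : ℂ) * ((Kerr.starAngle M a r : ℝ) : ℂ)))) (Ioi (Kerr.rPlus M a)) :=
      (contDiffOn_const.mul ((contDiffOn_const.mul hT).sub (contDiffOn_const.mul hA))).cexp
    exact hph.mul (contDiffOn_mdR (m := m) h p)
  -- agreement of the branches on the overlap
  have hagree : ∀ r ∈ Ioo (Kerr.rPlus M a) (Kerr.rPlus M a + ρ / 2), f₂ r = f₁ r := by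
    intro r hr
    simp only [hf₁, hf₂]
    rw [mdR_eq_loc h hR hp hpR hr]
    have hthis := exp_starPhase_eq (M := M) (a := a) (m := m) p.1 r
    set X : ℂ := Complex.I * (p.1 * ((Kerr.starTime M a r : ℝ) : ℂ) - (m : ℂ) * ((Kerr.starAngle M a r : ℝ) : ℂ)) with hX
    have e1 : Complex.exp X * Complex.exp (-X) = 1 := by rw [← Complex.exp_add, add_neg_cancel, Complex.exp_zero]
    have e2 : Complex.exp (Complex.I * p.1 * r) * Complex.exp (-(Complex.I * p.1 * r)) = 1 := by
      rw [← Complex.exp_add, add_neg_cancel, Complex.exp_zero]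
    linear_combination (Complex.exp (Complex.I * p.1 * r) * horU M a m p r) * e1 -
      (Complex.exp X * Complex.exp (Complex.I * p.1 * r) * horU M a m p r) * hthis -
      (Complex.exp X * radPhase M a m p.1 r * horU M a m p r) * e2
  -- assemble
  intro x hx
  by_cases hxl : x < Kerr.rPlus M a + ρ / 2
  · -- near `r₊`: `f = f₁` on a neighbourhood
    have hxI : x ∈ Ioo (Kerr.rPlus M a - ρ / 2) (Kerr.rPlus M a + ρ / 2) := ⟨by linarith [mem_Ioi.1 hx], hxl⟩
    have hnb : Ioo (Kerr.rPlus M a - ρ / 2) (Kerr.rPlus M a + ρ / 2) ∈ 𝓝 x := Ioo_mem_nhds hxI.1 hxI.2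
    have hc₁ : ContDiffAt ℝ ∞ f₁ x := (h₁ x hxI).contDiffAt hnb
    have hev : mdF M a m ρ p =ᶠ[𝓝 x] f₁ := by
      filter_upwards [hnb] with r hr
      unfold mdF
      split_ifs with hlt
      · rfl
      · push Not at hlt
        exact hagree r ⟨by linarith, hr.2⟩
    exact (hc₁.congr_of_eventuallyEq hev).contDiffWithinAt
  · -- far from `r₊`: `f = f₂` on a neighbourhood
    push Not at hxl
    have hxr : Kerr.rPlus M a + ρ / 4 < x := by linarith
    have hnb : Ioi (Kerr.rPlus M a + ρ / 4) ∈ 𝓝 x := Ioi_mem_nhds hxr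
    have hc₂ : ContDiffAt ℝ ∞ f₂ x := (h₂ x (show Kerr.rPlus M a < x by linarith)).contDiffAt (Ioi_mem_nhds (by linarith))
    have hev : mdF M a m ρ p =ᶠ[𝓝 x] f₂ := by
      filter_upwards [hnb] with r hr
      unfold mdF
      rw [if_neg (not_lt.2 (le_of_lt hr))]
    exact (hc₂.congr_of_eventuallyEq hev).contDiffWithinAt

/-- **`R ≠ 0` somewhere** (near `r₊`, `R = Φ u` with `u ≈ 1`). [folklore] -/
theorem exists_mdR_ne_zero (h : Kerr.IsSubextremal M a) {p : ℂ × ℂ × ℂ} (hp : p ∈ horGood M a) :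
    ∃ r ∈ Ioi (Kerr.rPlus M a), mdR M a m p r ≠ 0 := by
  set R := radR p
  have hR : 0 ≤ R := radR_nonneg p
  have hpR : p ∈ horBoxClosed R := mem_horBoxClosed_radR p
  have hρ := horRho_pos h hR
  set r := Kerr.rPlus M a + horRho M a R / 8 with hr
  have hrI : r ∈ Ioo (Kerr.rPlus M a) (Kerr.rPlus M a + horRho M a R / 2) := by simp only [hr]; constructor <;> linarith
  refine ⟨r, hrI.1, ?_⟩
  rw [mdR_eq_loc h hR hp hpR hrI]
  have habs : |r - Kerr.rPlus M a| ≤ horRho M a R / 8 := by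
    rw [abs_of_nonneg (by simp only [hr]; linarith)]; simp only [hr]; linarith
  exact mul_ne_zero (Complex.exp_ne_zero _) (re_horU_ge (m := m) h hR hp hpR habs).2

/-- **Exponential decay of `R` and `R'` from that of `(y, y')`.** If `‖y‖, ‖y'‖ ≤ C e^{−κt}` beyond
some `T`, then `‖R(r)‖, ‖R'(r)‖ ≤ C' e^{−κ r}` for all `r ≥ r₊ + 1` (`√Δ ≥ 1` there, and continuity on
the compact part). [folklore] -/
theorem decay_mdR (h : Kerr.IsSubextremal M a) (p : ℂ × ℂ × ℂ) {C T κ : ℝ} (hκ : 0 < κ)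
    (hy : ∀ t, T ≤ t → ‖radY M a m p t‖ ≤ C * Real.exp (-(κ * t)) ∧ ‖radY₁ M a m p t‖ ≤ C * Real.exp (-(κ * t))) :
    ∃ C' : ℝ, ∀ r : ℝ, Kerr.rPlus M a + 1 ≤ r →
      ‖mdR M a m p r‖ ≤ C' * Real.exp (-(κ * r)) ∧ ‖deriv (mdR M a m p) r‖ ≤ C' * Real.exp (-(κ * r)) := by
  have hrp := rPlus_pos_of_isSubextremal h
  set T' := max T (Kerr.rPlus M a + 1) with hT'
  -- bounds on the compact part `[r₊ + 1, T']`
  have hsol := isSol2_radY (m := m) h.le p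
  have hsub : Icc (Kerr.rPlus M a + 1) T' ⊆ Ioi (Kerr.rPlus M a) := fun s hs ↦ lt_of_lt_of_le (by linarith) hs.1
  obtain ⟨B₀, hB₀⟩ := (isCompact_Icc.image_of_continuousOn (hsol.continuousOn.1.mono hsub)).isBounded.exists_norm_le
  obtain ⟨B₁, hB₁⟩ := (isCompact_Icc.image_of_continuousOn (hsol.continuousOn.2.mono hsub)).isBounded.exists_norm_le
  set B := max (max B₀ B₁) 0 with hB
  set C₁ : ℝ := max (max C 0) (B * Real.exp (κ * T')) with hC₁
  have hC₁0 : 0 ≤ C₁ := (le_max_right _ _).trans (le_max_left _ _)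
  -- uniform bound `‖y‖, ‖y₁‖ ≤ C₁ e^{−κ r}` on `[r₊ + 1, ∞)`
  have hunif : ∀ r, Kerr.rPlus M a + 1 ≤ r → ‖radY M a m p r‖ ≤ C₁ * Real.exp (-(κ * r)) ∧
      ‖radY₁ M a m p r‖ ≤ C₁ * Real.exp (-(κ * r)) := by
    intro r hr
    rcases le_or_gt T' r with h1 | h1
    · obtain ⟨d0, d1⟩ := hy r ((le_max_left _ _).trans h1)
      have hE : 0 ≤ Real.exp (-(κ * r)) := (Real.exp_pos _).le
      have hCC : C * Real.exp (-(κ * r)) ≤ C₁ * Real.exp (-(κ * r)) :=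
        mul_le_mul_of_nonneg_right ((le_max_left C 0).trans (le_max_left _ _)) hE
      exact ⟨d0.trans hCC, d1.trans hCC⟩
    · have hrI : r ∈ Icc (Kerr.rPlus M a + 1) T' := ⟨hr, h1.le⟩
      have e0 : ‖radY M a m p r‖ ≤ B := (hB₀ _ (mem_image_of_mem _ hrI)).trans ((le_max_left _ _).trans (le_max_left _ _))
      have e1 : ‖radY₁ M a m p r‖ ≤ B := (hB₁ _ (mem_image_of_mem _ hrI)).trans ((le_max_right _ _).trans (le_max_left _ _))
      have hB0 : 0 ≤ B := le_max_right _ _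
      have hexp : B ≤ B * Real.exp (κ * T') * Real.exp (-(κ * r)) := by
        rw [mul_assoc, ← Real.exp_add]
        have : 1 ≤ Real.exp (κ * T' + -(κ * r)) := by rw [Real.one_le_exp_iff]; nlinarith
        nlinarith
      have hCC : B * Real.exp (κ * T') * Real.exp (-(κ * r)) ≤ C₁ * Real.exp (-(κ * r)) :=
        mul_le_mul_of_nonneg_right (le_max_right _ _) (Real.exp_pos _).le
      exact ⟨e0.trans (hexp.trans hCC), e1.trans (hexp.trans hCC)⟩
  refine ⟨(2 + Kerr.rPlus M a) * C₁, fun r hr ↦ ?_⟩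
  have hr' : Kerr.rPlus M a < r := by linarith
  obtain ⟨hS, hS2⟩ := sqrtDelta_pos h.le hr'
  obtain ⟨hΔx, hrx⟩ := sq_le_delta h hr
  have hS1 : 1 ≤ sqrtDelta M a r := by
    have : 1 ≤ Kerr.delta M a r := by nlinarith
    rw [sqrtDelta]; exact Real.one_le_sqrt.2 this
  have hSx : r - Kerr.rPlus M a ≤ sqrtDelta M a r := by
    rw [sqrtDelta, ← Real.sqrt_sq (show 0 ≤ r - Kerr.rPlus M a by linarith)]
    exact Real.sqrt_le_sqrt hΔx
  obtain ⟨d0, d1⟩ := hunif r hr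
  have hE : 0 ≤ C₁ * Real.exp (-(κ * r)) := by positivity
  constructor
  · rw [mdR, norm_div, Complex.norm_real, Real.norm_eq_abs, abs_of_pos (Real.sqrt_pos.2 (Kerr.delta_pos h.le hr'))]
    rw [div_le_iff₀ (Real.sqrt_pos.2 (Kerr.delta_pos h.le hr'))]
    have : sqrtDelta M a r = Real.sqrt (Kerr.delta M a r) := rfl
    rw [← this]
    have hge : 1 ≤ (2 + Kerr.rPlus M a) * sqrtDelta M a r := by nlinarith
    calc ‖radY M a m p r‖ ≤ C₁ * Real.exp (-(κ * r)) := d0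
      _ = C₁ * Real.exp (-(κ * r)) * 1 := by ring
      _ ≤ C₁ * Real.exp (-(κ * r)) * ((2 + Kerr.rPlus M a) * sqrtDelta M a r) := by gcongr
      _ = _ := by ring
  · rw [(hasDerivAt_mdR h p hr').deriv, mdR₁, mdFlux, norm_div, Complex.norm_real, Real.norm_eq_abs,
      abs_of_pos (Kerr.delta_pos h.le hr'), div_le_iff₀ (Kerr.delta_pos h.le hr'), ← hS2]
    have hn : ‖radY₁ M a m p r * ((sqrtDelta M a r : ℝ) : ℂ) - radY M a m p r * ((sqrtDelta₁ M a r : ℝ) : ℂ)‖ ≤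
        ‖radY₁ M a m p r‖ * sqrtDelta M a r + ‖radY M a m p r‖ * |sqrtDelta₁ M a r| := by
      refine (norm_sub_le _ _).trans ?_
      rw [norm_mul, norm_mul, Complex.norm_real, Complex.norm_real, Real.norm_eq_abs, Real.norm_eq_abs, abs_of_pos hS]
    refine hn.trans ?_
    -- `|S₁| = (r − M)/S ≤ (1 + r₊)`
    have hM : M < r := by
      have : Kerr.rPlus M a = M + Real.sqrt (M ^ 2 - a ^ 2) := rfl
      have := Real.sqrt_nonneg (M ^ 2 - a ^ 2); linarith
    have hS₁ : |sqrtDelta₁ M a r| ≤ 1 + Kerr.rPlus M a := by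
      rw [sqrtDelta₁, abs_div, abs_of_pos (by linarith : 0 < r - M), abs_of_pos hS, div_le_iff₀ hS]
      have hMpos := h.pos
      nlinarith [mul_le_mul_of_nonneg_left hSx (by linarith : (0 : ℝ) ≤ 1 + Kerr.rPlus M a)]
    have h1 : ‖radY₁ M a m p r‖ * sqrtDelta M a r ≤ C₁ * Real.exp (-(κ * r)) * sqrtDelta M a r :=
      mul_le_mul_of_nonneg_right d1 hS.le
    have h2 : ‖radY M a m p r‖ * |sqrtDelta₁ M a r| ≤ C₁ * Real.exp (-(κ * r)) * (1 + Kerr.rPlus M a) :=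
      mul_le_mul d0 hS₁ (abs_nonneg _) hE
    have k : sqrtDelta M a r + (1 + Kerr.rPlus M a) ≤ (2 + Kerr.rPlus M a) * sqrtDelta M a r ^ 2 := by nlinarith
    calc ‖radY₁ M a m p r‖ * sqrtDelta M a r + ‖radY M a m p r‖ * |sqrtDelta₁ M a r|
        ≤ C₁ * Real.exp (-(κ * r)) * sqrtDelta M a r + C₁ * Real.exp (-(κ * r)) * (1 + Kerr.rPlus M a) := add_le_add h1 h2
      _ = C₁ * Real.exp (-(κ * r)) * (sqrtDelta M a r + (1 + Kerr.rPlus M a)) := by ring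
      _ ≤ C₁ * Real.exp (-(κ * r)) * ((2 + Kerr.rPlus M a) * sqrtDelta M a r ^ 2) := by gcongr
      _ = _ := by ring

end RadialBack


/-! ### Separated mode data from a zero of the matching function -/

section Data

variable {M a : ℝ} {m : ℤ}

/-- The oblateness parameter `κ = a²(ω² − μ²)` in the form used by `angularData_of_shooting_zero`.
[cite: ShlapentokhRothman2014KleinGordon, §2 (2.1)] -/
def kapOf (a : ℝ) (w : ℂ) (μ : ℝ) : ℂ := ((a ^ 2 : ℝ) : ℂ) * (w ^ 2 - ((μ ^ 2 : ℝ) : ℂ))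

/-- For real `w`, `κ` is the real number `a²(w² − μ²)`. [folklore] -/
theorem kapOf_ofReal (a w μ : ℝ) : kapOf a (w : ℂ) μ = ((a ^ 2 * (w ^ 2 - μ ^ 2) : ℝ) : ℂ) := by
  unfold kapOf; push_cast; ring

/-- `κ` is continuous in `(w, μ)`. [folklore] -/
theorem continuous_kapOf (a : ℝ) : Continuous fun q : ℂ × ℝ ↦ kapOf a q.1 q.2 := by
  unfold kapOf; fun_prop

/-- **The separated data of a mode from a zero of the matching function.** Let `Im w ≥ 0`, let `ν`
be a zero of the spheroidal shooting function at `κ = a²(w² − μ²)`, and suppose the matching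
function vanishes at the admissible parameter `p = (w, ν + m₀(m₀+1), μ²)` (`m₀ = |m|`, `m ≠ 0`).
Then all the separated data of `ShlapentokhRothman2014_separatedMode` at `(μ, w)` exist: angular
eigenfunction and its smooth spherical extension, a radial solution of (2.2) of the horizon form
`e^{−i(ωt̄ − mφ̄)} f` with `f` smooth across `r₊`, non-trivial, exponentially decaying with its
derivative. [cite: ShlapentokhRothman2014KleinGordon, Thm. 1.2 and §2] -/
theorem separated_data_of_zero (h : Kerr.IsSubextremal M a) (hm : m ≠ 0) {R g R₁ : ℝ} (hR : 0 ≤ R) (hg : 0 < g)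
    (hM : IsMatchRadius M a m R g R₁) {w : ℂ} (hw : 0 ≤ w.im) {μ : ℝ} {ν : ℂ}
    (hν : sphmShoot m.natAbs (ν, kapOf a w μ) = 0)
    (hadm : IsAdm R g (w, ν + (m.natAbs : ℂ) * ((m.natAbs : ℂ) + 1), ((μ ^ 2 : ℝ) : ℂ)))
    (hA : matchA M a m h (hM.le h hR hg) hg (w, ν + (m.natAbs : ℂ) * ((m.natAbs : ℂ) + 1), ((μ ^ 2 : ℝ) : ℂ)) = 0) :
    ∃ (Λ : ℂ) (S : ℝ → ℂ) (Y : E3 → ℂ),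
      IsAngularSolution a w μ m Λ S ∧ IsSphericalExtension m S Y ∧ (∃ θ ∈ Ioo 0 Real.pi, S θ ≠ 0) ∧
      ∃ Rf f : ℝ → ℂ, IsRadialSolution M a w m Λ μ Rf ∧
        (∃ η > (0 : ℝ), ContDiffOn ℝ ∞ f (Ioi (Kerr.rPlus M a - η))) ∧
        (∀ r ∈ Ioi (Kerr.rPlus M a),
          Rf r = Complex.exp (-(Complex.I * (w * ((Kerr.starTime M a r : ℝ) : ℂ) -
            (m : ℂ) * ((Kerr.starAngle M a r : ℝ) : ℂ)))) * f r) ∧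
        (∃ r ∈ Ioi (Kerr.rPlus M a), Rf r ≠ 0) ∧
        ∃ C κ : ℝ, 0 < κ ∧ ∀ r : ℝ, Kerr.rPlus M a + 1 ≤ r →
          ‖Rf r‖ ≤ C * Real.exp (-(κ * r)) ∧ ‖deriv Rf r‖ ≤ C * Real.exp (-(κ * r)) := by
  set Λ : ℂ := ν + (m.natAbs : ℂ) * ((m.natAbs : ℂ) + 1) with hΛ
  set p : ℂ × ℂ × ℂ := (w, Λ, ((μ ^ 2 : ℝ) : ℂ)) with hp
  have hν' : sphmDer m.natAbs ν (((a ^ 2 : ℝ) : ℂ) * (w ^ 2 - ((μ ^ 2 : ℝ) : ℂ))) 1 = 0 := hν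
  obtain ⟨S, Y, hS, hY, hSne⟩ := angularData_of_shooting_zero a w μ hm hν'
  have hpg : p ∈ horGood M a := mem_horGood_of_im_nonneg h hw
  set R' := radR p with hR'
  have hR'0 : 0 ≤ R' := radR_nonneg p
  have hpR' : p ∈ horBoxClosed R' := mem_horBoxClosed_radR p
  have hρ := horRho_pos h hR'0
  refine ⟨Λ, S, Y, hS, hY, hSne, mdR M a m p, mdF M a m (horRho M a R') p, isRadialSolution_mdR h w Λ μ,
    ⟨horRho M a R' / 4, by positivity, contDiffOn_mdF h hR'0 hpg hpR'⟩,
    fun r hr ↦ mdR_eq_phase_mul_mdF h hR'0 hpg hpR' hr, exists_mdR_ne_zero h hpg, ?_⟩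
  obtain ⟨C, hC⟩ := decay_of_matchA_eq_zero h hR hg hM hadm hA
  have hγ : 0 < gam1 g := by unfold gam1; have := Real.sqrt_pos.2 hg; positivity
  obtain ⟨C', hC'⟩ := decay_mdR (m := m) h p hγ hC
  exact ⟨C', gam1 g, hγ, hC'⟩

/-- **The mode built from a zero of the matching function is superradiant** (Shlapentokh-Rothman,
CMP 329 (2014), Prop. 4.6 with Prop. B.2). In the situation of `separated_data_of_zero` with
`Im w > 0` and `a²‖w‖² ≤ m₀(m₀+1)` (`m₀ = |m| ≥ 1`), the radial function `R = mdR` satisfies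
`2Mr₊‖w‖ < |am|`: `superradiant_of_isRadialSolution` (the monotone current `Im(Δ R' ω̄ R̄)` of the
proof of Prop. 4.6) applies, its angular hypothesis `Im((λ + a²ω²)ω̄) < 0` being
`im_angular_mul_conj_neg` for the eigen-triple `λ = ν + m₀(m₀+1)`, its horizon hypothesis
`Δ R' R̄ → 0` being `tendsto_horizonFlux_of_horizonForm` for the horizon form
`R = e^{−i(ωt̄ − mφ̄)} f` (`mdR_eq_phase_mul_mdF`, `f = mdF` smooth across `r₊`), and the decay of
`R`, `R'` coming from the vanishing of the matching function (`decay_of_matchA_eq_zero`, `decay_mdR`).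
[cite: ShlapentokhRothman2014KleinGordon, Prop. 4.6 and App. B Prop. B.2] -/
theorem superradiant_mdR_of_zero (h : Kerr.IsSubextremal M a) (hm : m ≠ 0) {R g R₁ : ℝ} (hR : 0 ≤ R) (hg : 0 < g)
    (hM : IsMatchRadius M a m R g R₁) {w : ℂ} (hw : 0 < w.im) {μ : ℝ} {ν : ℂ}
    (hν : sphmShoot m.natAbs (ν, kapOf a w μ) = 0)
    (hsmall : a ^ 2 * ‖w‖ ^ 2 ≤ (m.natAbs : ℝ) * ((m.natAbs : ℝ) + 1))
    (hadm : IsAdm R g (w, ν + (m.natAbs : ℂ) * ((m.natAbs : ℂ) + 1), ((μ ^ 2 : ℝ) : ℂ)))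
    (hA : matchA M a m h (hM.le h hR hg) hg (w, ν + (m.natAbs : ℂ) * ((m.natAbs : ℂ) + 1), ((μ ^ 2 : ℝ) : ℂ)) = 0) :
    2 * M * Kerr.rPlus M a * ‖w‖ < |a * m| := by
  set Λ : ℂ := ν + (m.natAbs : ℂ) * ((m.natAbs : ℂ) + 1) with hΛ
  set p : ℂ × ℂ × ℂ := (w, Λ, ((μ ^ 2 : ℝ) : ℂ)) with hp
  have hν' : sphmDer m.natAbs ν (((a ^ 2 : ℝ) : ℂ) * (w ^ 2 - ((μ ^ 2 : ℝ) : ℂ))) 1 = 0 := hν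
  -- the angular input (Prop. B.2 near the threshold)
  have hΛim : ((Λ + ((a ^ 2 : ℝ) : ℂ) * w ^ 2) * conj w).im < 0 :=
    im_angular_mul_conj_neg (Int.natAbs_pos.2 hm) hν' hw hsmall
  have hpg : p ∈ horGood M a := mem_horGood_of_im_nonneg h hw.le
  set R' := radR p with hR'
  have hR'0 : 0 ≤ R' := radR_nonneg p
  have hpR' : p ∈ horBoxClosed R' := mem_horBoxClosed_radR p
  have hρ := horRho_pos h hR'0
  -- the radial solution, non-trivial, with vanishing horizon flux and exponential decay
  have hsol : IsRadialSolution M a w m Λ μ (mdR M a m p) := isRadialSolution_mdR h w Λ μ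
  have hne : ∃ r ∈ Ioi (Kerr.rPlus M a), mdR M a m p r ≠ 0 := exists_mdR_ne_zero h hpg
  have hhor : Tendsto (fun r : ℝ ↦ ((Kerr.delta M a r : ℝ) : ℂ) * deriv (mdR M a m p) r * conj (mdR M a m p r))
      (𝓝[>] (Kerr.rPlus M a)) (𝓝 0) :=
    tendsto_horizonFlux_of_horizonForm h hw m (f := mdF M a m (horRho M a R') p) (η := horRho M a R' / 4)
      (by positivity) ((contDiffOn_mdF h hR'0 hpg hpR').of_le (by simp))
      (fun r hr ↦ mdR_eq_phase_mul_mdF h hR'0 hpg hpR' hr)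
  obtain ⟨C, hC⟩ := decay_of_matchA_eq_zero h hR hg hM hadm hA
  have hγ : 0 < gam1 g := by unfold gam1; have := Real.sqrt_pos.2 hg; positivity
  obtain ⟨C', hC'⟩ := decay_mdR (m := m) h p hγ hC
  -- Prop. 4.6
  exact superradiant_of_isRadialSolution h hw hΛim hsol hne hhor ⟨C', gam1 g, hγ, hC'⟩

end Data

/-! ### The glue: separated data without the superradiance clause ⟹ the barrier fact -/

section Glue

/-- **The separated-mode statement (superradiance clause dropped) ⟹ `KleinGordonSuperradiantInstability`.**
This re-runs the two proved reductions of `KleinGordonModeConstruction.lean`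
(`ShlapentokhRothman2014_unstableModeProfile.of_separated`, which merely carries the clause) and
`KleinGordonSuperradiantInstabilityProofs.lean` (`of_unstableModeProfile`, which discards it):
Carter separation on the leaf (`CarterSeparationKSLeaf_holds`), decay and smoothness of the leaf
profile, and the energy growth of the real mode. [cite: ShlapentokhRothman2014KleinGordon, Thm. 1.1 and Thm. 1.2] -/
theorem KleinGordonSuperradiantInstability.of_separated_data
    (hX : ∀ (M a : ℝ), Kerr.IsSubextremal M a → a ≠ 0 → ∀ m : ℤ, m ≠ 0 → ∀ δ > (0 : ℝ),
      ∃ μ > (0 : ℝ), |μ - |a * m| / (2 * M * Kerr.rPlus M a)| < δ ∧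
      ∃ w : ℂ, 0 < w.im ∧ w.re ≠ 0 ∧
      ∃ (Λ : ℂ) (S : ℝ → ℂ) (Y : E3 → ℂ),
        IsAngularSolution a w μ m Λ S ∧ IsSphericalExtension m S Y ∧ (∃ θ ∈ Ioo 0 Real.pi, S θ ≠ 0) ∧
        ∃ R f : ℝ → ℂ, IsRadialSolution M a w m Λ μ R ∧
          (∃ η > (0 : ℝ), ContDiffOn ℝ ∞ f (Ioi (Kerr.rPlus M a - η))) ∧
          (∀ r ∈ Ioi (Kerr.rPlus M a),
            R r = Complex.exp (-(Complex.I * (w * ((Kerr.starTime M a r : ℝ) : ℂ) -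
              (m : ℂ) * ((Kerr.starAngle M a r : ℝ) : ℂ)))) * f r) ∧
          (∃ r ∈ Ioi (Kerr.rPlus M a), R r ≠ 0) ∧
          ∃ C κ : ℝ, 0 < κ ∧ ∀ r : ℝ, Kerr.rPlus M a + 1 ≤ r →
            ‖R r‖ ≤ C * Real.exp (-(κ * r)) ∧ ‖deriv R r‖ ≤ C * Real.exp (-(κ * r))) :
    KleinGordonSuperradiantInstability := by
  intro _ _ M a hMa ha m hm δ hδ
  obtain ⟨μ, hμ, hμδ, w, hwim, hwre, Λ, S, Y, hS, hY, ⟨θ₀, hθ₀, hSθ₀⟩, R, f, hR, ⟨η, hη, hf⟩,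
    hRf, ⟨r₁, hr₁, hRr₁⟩, C, κ, hκ, hdec⟩ := hX M a hMa ha m hm δ hδ
  have hrp : 0 < Kerr.rPlus M a := hMa.rPlus_pos
  obtain ⟨C₁, hgd, hg⟩ := exists_bound_ksRadial (m := m) hMa hwim.le hη hκ hf hRf
    (hR.1.differentiableOn (by simp)) hdec
  have hgs : ContDiffOn ℝ ∞ (ksRadial M a w m R) (Ioi (Kerr.rPlus M a)) := by
    have hof : ContDiff ℝ ∞ (fun r : ℝ ↦ (r : ℂ)) := Complex.ofRealCLM.contDiff
    have h1 : ContDiffOn ℝ ∞ (fun r : ℝ ↦ Complex.exp (-(Complex.I * w) * (r : ℂ)) * f r)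
        (Ioi (Kerr.rPlus M a)) :=
      ((contDiff_const.mul hof).cexp.contDiffOn).mul (hf.mono (Ioi_subset_Ioi (by linarith)))
    exact h1.congr fun r hr ↦ ksRadial_eq hRf hr
  obtain ⟨C₂, hdecay⟩ := exists_decay_ksProfile (a := a) (Y := Y) hrp hκ hgd hg hY.1
  -- the profile
  set Φ := ksProfile a (ksRadial M a w m R) Y with hΦ
  have hΦs : ContDiffOn ℝ ∞ Φ (Kerr.slice a (Kerr.rPlus M a)) := contDiffOn_ksProfile hgs hY.1
  have hr₁0 : 0 < r₁ := hrp.trans hr₁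
  have hne : ∃ y ∈ Kerr.slice a (Kerr.rPlus M a), Φ y ≠ 0 := by
    refine ⟨Kerr.kerrStar a r₁ θ₀ 0, Kerr.kerrStar_mem_slice (max_lt hr₁ hr₁0) θ₀ 0, ?_⟩
    rw [hΦ, ksProfile_kerrStar a _ Y hr₁0, hY.2.2 θ₀ hθ₀ 0, ksRadial]
    exact mul_ne_zero (mul_ne_zero (Complex.exp_ne_zero _) hRr₁) (mul_ne_zero (Complex.exp_ne_zero _) hSθ₀)
  have hsol : ∀ y ∈ Kerr.slice a (Kerr.rPlus M a), reducedWaveOp M a w Φ y = μ ^ 2 * Φ y := fun y hy ↦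
    CarterSeparationKSLeaf_holds M a hMa w m Λ μ S Y R hS hY hR y hy
  obtain ⟨c₀, hc₀, hsmooth, hfin, hgrow⟩ := exists_sliceEnergy_growth_of_mode (w := w) hμ.ne' hwre hΦs hne hκ hdecay
  exact ⟨μ, hμ, hμδ, 2 * w.im, by positivity, c₀, hc₀, fun x ↦ modeRe w Φ x, hsmooth,
    dalembertian_modeRe_of_reducedWaveOp w hΦs hsol, fun τ _ ↦ hfin τ, fun τ _ ↦ hgrow τ⟩

end Glue


/-! ### The matching function at real threshold parameters -/

section ThresholdMatch

variable {M a : ℝ} {m : ℤ}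

/-- Real parts of scaled complex solutions with real coefficient are real solutions. [folklore] -/
theorem isSol2_re_smul {q : ℝ → ℝ} {Q : ℝ → ℂ} {y y' : ℝ → ℂ} {s : Set ℝ} (hy : IsSol2 Q y y' s)
    (hQ : ∀ t ∈ s, Q t = ((q t : ℝ) : ℂ)) (c : ℂ) :
    IsSol2 q (fun t ↦ (c * y t).re) (fun t ↦ (c * y' t).re) s := by
  have hs := hy.smul c
  refine ⟨fun t ht ↦ Complex.reCLM.hasFDerivAt.comp_hasDerivAt t (hs.hasDerivAt t ht), fun t ht ↦ ?_⟩
  have h1 := Complex.reCLM.hasFDerivAt.comp_hasDerivAt t (hs.hasDerivAt_deriv t ht)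
  refine h1.congr_deriv ?_
  show (Q t * (c * y t)).re = q t * (c * y t).re
  rw [hQ t ht, Complex.re_ofReal_mul]

/-- **Structure at real threshold parameters.** For real admissible `p = (ω₀, Λ, σ)`, with the unit
`u = y_rec(R₁+1)/‖y_rec(R₁+1)‖`, the functions `ρ = re(conj u · y_rec)`, `ρ₁ = re(conj u · y_rec')` are a
positive real solution pair on `(R₁, ∞)` with `y_rec = u ρ`, `y_rec' = u ρ₁`, and
`𝔞(p) = u Φ₀ · W(ρ, z)(R₁ + 1)` with the real threshold solution `z = thrZ`.
[cite: ShlapentokhRothman2014KleinGordon, §4.2–§4.3] -/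
theorem matchA_thrP_eq (h : Kerr.IsSubextremal M a) {R g R₁ : ℝ} (hR : 0 ≤ R) (hg : 0 < g)
    (hM : IsMatchRadius M a m R g R₁) (Λ σ : ℝ) (hp : IsAdm R g (thrP M a m Λ σ)) :
    ∃ (u : ℂ) (ρ ρ₁ : ℝ → ℝ),
      u = recY M a m h (hM.le h hR hg) hg (thrP M a m Λ σ) (R₁ + 1) /
        (‖recY M a m h (hM.le h hR hg) hg (thrP M a m Λ σ) (R₁ + 1)‖ : ℂ) ∧
      (ρ = fun t ↦ (conj u * recY M a m h (hM.le h hR hg) hg (thrP M a m Λ σ) t).re) ∧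
      ‖u‖ = 1 ∧ IsSol2 (thrQ M a m Λ σ) ρ ρ₁ (Ioi R₁) ∧ (∀ t ∈ Ioi R₁, 0 < ρ t) ∧
      (∀ t ∈ Ioi R₁, recY M a m h (hM.le h hR hg) hg (thrP M a m Λ σ) t = u * (ρ t : ℂ) ∧
        recY₁ M a m h (hM.le h hR hg) hg (thrP M a m Λ σ) t = u * (ρ₁ t : ℂ)) ∧
      matchA M a m h (hM.le h hR hg) hg (thrP M a m Λ σ) =
        u * thrPhase0 M a m * ((wronskian ρ ρ₁ (thrZ M a m Λ σ) (thrZ₁ M a m Λ σ) (R₁ + 1) : ℝ) : ℂ) := by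
  have hpeq : thrP M a m (Λ : ℂ) (σ : ℂ) = (((omega0 M a m : ℝ) : ℂ), (Λ : ℂ), (σ : ℂ)) := rfl
  obtain ⟨hu, hreal⟩ := recY_real h hR hg hM (omega0 M a m) Λ σ (by rw [← hpeq]; exact hp)
  set u : ℂ := recY M a m h (hM.le h hR hg) hg (thrP M a m Λ σ) (R₁ + 1) /
    (‖recY M a m h (hM.le h hR hg) hg (thrP M a m Λ σ) (R₁ + 1)‖ : ℂ) with hu_def
  set ρ : ℝ → ℝ := fun t ↦ (conj u * recY M a m h (hM.le h hR hg) hg (thrP M a m Λ σ) t).re with hρ_def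
  set ρ₁ : ℝ → ℝ := fun t ↦ (conj u * recY₁ M a m h (hM.le h hR hg) hg (thrP M a m Λ σ) t).re with hρ₁_def
  have hu' : ‖u‖ = 1 := hu
  have hreal' : ∀ t ∈ Ioi R₁, (conj u * recY M a m h (hM.le h hR hg) hg (thrP M a m Λ σ) t).im = 0 ∧
      (conj u * recY₁ M a m h (hM.le h hR hg) hg (thrP M a m Λ σ) t).im = 0 ∧
      0 < (conj u * recY M a m h (hM.le h hR hg) hg (thrP M a m Λ σ) t).re := hreal
  have hsol : IsSol2 (radQ M a m (thrP M a m Λ σ)) (recY M a m h (hM.le h hR hg) hg (thrP M a m Λ σ))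
      (recY₁ M a m h (hM.le h hR hg) hg (thrP M a m Λ σ)) (Ioi R₁) := isSol2_recY h hR hg hM hp
  have hρsol : IsSol2 (thrQ M a m Λ σ) ρ ρ₁ (Ioi R₁) :=
    isSol2_re_smul hsol (fun t _ ↦ (thrQ_ofReal Λ σ t).symm) (conj u)
  have huu : u * conj u = 1 := by
    rw [Complex.mul_conj, Complex.normSq_eq_norm_sq, hu']; simp
  have hrep : ∀ t ∈ Ioi R₁, recY M a m h (hM.le h hR hg) hg (thrP M a m Λ σ) t = u * (ρ t : ℂ) ∧
      recY₁ M a m h (hM.le h hR hg) hg (thrP M a m Λ σ) t = u * (ρ₁ t : ℂ) := by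
    intro t ht
    obtain ⟨h0, h1, -⟩ := hreal' t ht
    have e0 : conj u * recY M a m h (hM.le h hR hg) hg (thrP M a m Λ σ) t = (ρ t : ℂ) :=
      Complex.ext (by simp [hρ_def]) (by rw [Complex.ofReal_im]; exact h0)
    have e1 : conj u * recY₁ M a m h (hM.le h hR hg) hg (thrP M a m Λ σ) t = (ρ₁ t : ℂ) :=
      Complex.ext (by simp [hρ₁_def]) (by rw [Complex.ofReal_im]; exact h1)
    constructor
    · rw [← e0, ← mul_assoc, huu, one_mul]
    · rw [← e1, ← mul_assoc, huu, one_mul]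
  have hR₁r : Kerr.rPlus M a < R₁ + 1 := by linarith [hM.le h hR hg]
  refine ⟨u, ρ, ρ₁, rfl, rfl, hu', hρsol, fun t ht ↦ (hreal' t ht).2.2, hrep, ?_⟩
  obtain ⟨e0, e1⟩ := hrep (R₁ + 1) (by simp)
  obtain ⟨f0, f1⟩ := radY_thrP_eq (m := m) h Λ σ hR₁r
  rw [matchA, wronskian, e0, e1, f0, f1, wronskian]
  push_cast
  ring

/-- **The real Wronskian `W(ρ, z)` is constant on `(R₁, ∞)`** (same real equation). [folklore] -/
theorem wronskian_thr_const (h : Kerr.IsSubextremal M a) {R₁ : ℝ} (hR₁ : Kerr.rPlus M a + 1 ≤ R₁) {Λ σ : ℝ}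
    {ρ ρ₁ : ℝ → ℝ} (hρ : IsSol2 (thrQ M a m Λ σ) ρ ρ₁ (Ioi R₁)) {t₁ t₂ : ℝ} (h₁ : R₁ < t₁) (h₂ : R₁ < t₂) :
    wronskian ρ ρ₁ (thrZ M a m Λ σ) (thrZ₁ M a m Λ σ) t₁ = wronskian ρ ρ₁ (thrZ M a m Λ σ) (thrZ₁ M a m Λ σ) t₂ :=
  hρ.wronskian_eq ((isSol2_thrZ (m := m) h Λ σ).mono fun s hs ↦
    lt_of_lt_of_le (show Kerr.rPlus M a < R₁ by linarith) (le_of_lt hs)) h₁ h₂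

/-- **A decaying threshold solution is a mode**: if `z = thrZ Λ σ` decays exponentially together
with `z₁`, then `𝔞(ω₀, Λ, σ) = 0`. [cite: ShlapentokhRothman2014KleinGordon, §4.2] -/
theorem matchA_thrP_eq_zero_of_decay (h : Kerr.IsSubextremal M a) {R g R₁ : ℝ} (hR : 0 ≤ R) (hg : 0 < g)
    (hM : IsMatchRadius M a m R g R₁) {Λ σ : ℝ} (hp : IsAdm R g (thrP M a m Λ σ))
    (hdec : ∃ S C κ : ℝ, 0 < κ ∧ ∀ t : ℝ, S ≤ t →
      |thrZ M a m Λ σ t| ≤ C * Real.exp (-(κ * t)) ∧ |thrZ₁ M a m Λ σ t| ≤ C * Real.exp (-(κ * t))) :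
    matchA M a m h (hM.le h hR hg) hg (thrP M a m Λ σ) = 0 := by
  obtain ⟨u, ρ, ρ₁, hu_def, hρ_def, hu, hρsol, -, hrep, hA⟩ := matchA_thrP_eq h hR hg hM Λ σ hp
  obtain ⟨S, C, κ, hκ, hdec⟩ := hdec
  -- `W(ρ, z) → 0` at infinity, and it is constant
  have hγ : 0 < gam1 g := by unfold gam1; have := Real.sqrt_pos.2 hg; positivity
  set C₀ := 3 * (1 + Real.sqrt g) * Real.exp (gam1 g * R₁)
  have hlim : Tendsto (wronskian ρ ρ₁ (thrZ M a m Λ σ) (thrZ₁ M a m Λ σ)) atTop (𝓝 0) := by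
    refine tendsto_wronskian_zero_of_decay (T := max S (R₁ + 1)) (C := C₀) (C' := C) (κ := gam1 g) (κ' := κ) (by positivity)
      (fun t ht ↦ ?_) (fun t ht ↦ ?_)
    · have htR : R₁ < t := by have := le_max_right S (R₁ + 1); linarith
      obtain ⟨d0, d1⟩ := recY_decay h hR hg hM hp (t := t) htR.le
      obtain ⟨r0, r1⟩ := hrep t htR
      have k0 : ‖ρ t‖ ≤ ‖recY M a m h (hM.le h hR hg) hg (thrP M a m Λ σ) t‖ := by
        rw [r0, norm_mul, hu, one_mul, Complex.norm_real]
      have k1 : ‖ρ₁ t‖ ≤ ‖recY₁ M a m h (hM.le h hR hg) hg (thrP M a m Λ σ) t‖ := by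
        rw [r1, norm_mul, hu, one_mul, Complex.norm_real]
      exact ⟨k0.trans d0, k1.trans d1⟩
    · obtain ⟨d0, d1⟩ := hdec t ((le_max_left _ _).trans ht)
      exact ⟨by rw [Real.norm_eq_abs]; exact d0, by rw [Real.norm_eq_abs]; exact d1⟩
  have hconst : ∀ t ∈ Ioi R₁, wronskian ρ ρ₁ (thrZ M a m Λ σ) (thrZ₁ M a m Λ σ) t =
      wronskian ρ ρ₁ (thrZ M a m Λ σ) (thrZ₁ M a m Λ σ) (R₁ + 1) := fun t ht ↦
    wronskian_thr_const h (hM.le h hR hg) hρsol ht (by linarith)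
  have hW0 : wronskian ρ ρ₁ (thrZ M a m Λ σ) (thrZ₁ M a m Λ σ) (R₁ + 1) = 0 := by
    have hlim2 : Tendsto (wronskian ρ ρ₁ (thrZ M a m Λ σ) (thrZ₁ M a m Λ σ)) atTop
        (𝓝 (wronskian ρ ρ₁ (thrZ M a m Λ σ) (thrZ₁ M a m Λ σ) (R₁ + 1))) := by
      refine tendsto_const_nhds.congr' ?_
      filter_upwards [eventually_gt_atTop R₁] with t ht using (hconst t ht).symm
    exact tendsto_nhds_unique hlim2 hlim
  rw [hA, hW0, Complex.ofReal_zero, mul_zero]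

/-- **Sign of `W(ρ, z)` when `z` has a first zero beyond `R₁ + 1`.** If `z = thrZ Λ σ` is positive
on `(r₊, R₁ + 1]` and vanishes somewhere, then `W(ρ, z)(R₁ + 1) < 0` for every positive real
solution `ρ` on `(R₁, ∞)`: at the first zero `t_z`, `W = ρ(t_z) z'(t_z)` with `z'(t_z) < 0`.
[cite: Hartman2002, Ch. XI §6; ShlapentokhRothman2014KleinGordon, §4.3] -/
theorem wronskian_thr_neg (h : Kerr.IsSubextremal M a) {R₁ : ℝ} (hR₁ : Kerr.rPlus M a + 1 ≤ R₁) {Λ σ : ℝ}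
    {ρ ρ₁ : ℝ → ℝ} (hρ : IsSol2 (thrQ M a m Λ σ) ρ ρ₁ (Ioi R₁)) (hρpos : ∀ t ∈ Ioi R₁, 0 < ρ t)
    (hzpos : ∀ t ∈ Ioc (Kerr.rPlus M a) (R₁ + 1), 0 < thrZ M a m Λ σ t)
    (hzero : ∃ t ∈ Ioi (Kerr.rPlus M a), thrZ M a m Λ σ t = 0) :
    wronskian ρ ρ₁ (thrZ M a m Λ σ) (thrZ₁ M a m Λ σ) (R₁ + 1) < 0 := by
  set z := thrZ M a m Λ σ with hz_def
  set z₁ := thrZ₁ M a m Λ σ with hz₁_def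
  have hz := isSol2_thrZ (m := m) h Λ σ
  have hR₁r : Kerr.rPlus M a < R₁ := by linarith
  set t₁ := R₁ + 1 with ht₁
  -- the zero set beyond `t₁` and its infimum
  set Zs : Set ℝ := {t | t₁ ≤ t ∧ z t = 0} with hZs
  obtain ⟨t', ht', hzt'⟩ := hzero
  have ht'1 : t₁ < t' := by
    by_contra hle; push Not at hle
    exact (hzpos t' ⟨ht', hle⟩).ne' hzt'
  have hZne : Zs.Nonempty := ⟨t', ht'1.le, hzt'⟩
  have hZbdd : BddBelow Zs := ⟨t₁, fun t ht ↦ ht.1⟩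
  have hZclosed : IsClosed Zs := by
    have hc : ContinuousOn z (Ici t₁) := hz.continuousOn.1.mono fun s hs ↦
      lt_of_lt_of_le (show Kerr.rPlus M a < t₁ by simp only [ht₁]; linarith) hs
    have : Zs = Ici t₁ ∩ z ⁻¹' {0} := by ext t; simp [hZs]
    rw [this]
    exact hc.preimage_isClosed_of_isClosed isClosed_Ici isClosed_singleton
  set tz := sInf Zs with htz
  have htzZ : tz ∈ Zs := hZclosed.csInf_mem hZne hZbdd
  have htz1 : t₁ < tz := by
    rcases eq_or_lt_of_le htzZ.1 with heq | hlt
    · exact absurd htzZ.2 (by rw [← heq]; exact (hzpos t₁ ⟨by linarith, le_rfl⟩).ne')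
    · exact hlt
  have htzr : Kerr.rPlus M a < tz := by linarith
  -- `z > 0` on `(r₊, tz)`
  have hne : ∀ t, Kerr.rPlus M a < t → t < tz → z t ≠ 0 := by
    intro t ht httz h0
    rcases le_or_gt t t₁ with h1 | h1
    · exact (hzpos t ⟨ht, h1⟩).ne' h0
    · have : t ∈ Zs := ⟨h1.le, h0⟩
      exact absurd (csInf_le hZbdd this) (not_le.2 httz)
  have hpos : ∀ t, Kerr.rPlus M a < t → t < tz → 0 < z t := by
    intro t ht httz
    by_contra hle; push Not at hle
    have hlt : z t < 0 := lt_of_le_of_ne hle (hne t ht httz)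
    have h1 : t₁ < t := by
      by_contra h2; push Not at h2; exact absurd (hzpos t ⟨ht, h2⟩) (not_lt.2 hle)
    have hc : ContinuousOn z (Icc t₁ t) := hz.continuousOn.1.mono fun s hs ↦
      lt_of_lt_of_le (show Kerr.rPlus M a < t₁ by simp only [ht₁]; linarith) hs.1
    obtain ⟨s, hs, hs0⟩ := intermediate_value_Icc' h1.le hc ⟨hlt.le, (hzpos t₁ ⟨by linarith, le_rfl⟩).le⟩
    exact hne s (by linarith [hs.1]) (lt_of_le_of_lt hs.2 httz) hs0
  -- `z₁(tz) < 0`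
  have hd : HasDerivAt z (z₁ tz) tz := hz.hasDerivAt tz htzr
  have hz₁ne : z₁ tz ≠ 0 := IsSol2.deriv_ne_zero_of_zero (continuousOn_thrQ h.le Λ σ) hz htzr htzZ.2
    ⟨t₁, by simp only [ht₁]; linarith, (hzpos t₁ ⟨by simp only [ht₁]; linarith, le_rfl⟩).ne'⟩
  have hz₁le : z₁ tz ≤ 0 := by
    have hsl := (hasDerivAt_iff_tendsto_slope.1 hd).mono_left (nhdsLT_le_nhdsNE tz)
    refine le_of_tendsto hsl ?_
    filter_upwards [Ioo_mem_nhdsLT htzr] with t ht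
    rw [slope_def_field, htzZ.2]
    have h1 : 0 < z t := hpos t ht.1 ht.2
    have h2 : t - tz < 0 := by linarith [ht.2]
    rw [sub_zero]
    exact (div_neg_of_pos_of_neg h1 h2).le
  have hz₁neg : z₁ tz < 0 := lt_of_le_of_ne hz₁le hz₁ne
  -- conclude with the constancy of `W`
  rw [wronskian_thr_const h hR₁ hρ (by simp only [ht₁]; linarith : R₁ < t₁) (by linarith : R₁ < tz), wronskian,
    show thrZ M a m Λ σ tz = 0 from htzZ.2, mul_zero, sub_zero]
  exact mul_neg_of_pos_of_neg (hρpos tz (by simp only [mem_Ioi]; linarith)) hz₁neg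

end ThresholdMatch


/-! ### The derivative of the matching function at a threshold zero (simplicity of the zero) -/

section DerivIdentity

variable {M a : ℝ} {m : ℤ}

/-- **Strict admissibility** (an open condition): `p` in the OPEN box with the gap condition. [folklore] -/
def IsAdmS (R g : ℝ) (p : ℂ × ℂ × ℂ) : Prop := p ∈ horBox R ∧ ‖(p.2.2 - p.1 ^ 2) - g‖ < 3 * g / 8

/-- Strict admissibility implies admissibility. [folklore] -/
theorem IsAdmS.isAdm {R g : ℝ} {p : ℂ × ℂ × ℂ} (hp : IsAdmS R g p) : IsAdm R g p :=
  ⟨horBox_subset_horBoxClosed R hp.1, hp.2⟩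

/-- The strictly admissible set is open. [folklore] -/
theorem isOpen_isAdmS (R g : ℝ) : IsOpen {p : ℂ × ℂ × ℂ | IsAdmS R g p} := by
  have h1 : IsOpen {p : ℂ × ℂ × ℂ | ‖(p.2.2 - p.1 ^ 2) - g‖ < 3 * g / 8} :=
    isOpen_lt (by fun_prop) continuous_const
  exact (isOpen_horBox R).inter h1

/-- **The derivative identity at a threshold zero.** Let `P` be a `C¹` complex curve of parameters
through a strictly admissible point `P(ζ₀)`, REAL on the real axis near `ζ₀`
(`P(ζ) = (ζ, Λ(ζ), σ)` for real `ζ`), with `𝔞(P(ζ₀)) = 0`. Then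
`im(∂_ζ(𝔞∘P)(ζ₀) · conj(y_rec(t₁) y(t₁))) = −2Mr₊ ‖y_rec(t₁)‖²` (`t₁ = R₁ + 1`) — differentiate
the current identity `im(𝔞 conj(y_rec y)) = (am − 2Mζr₊)‖y_rec‖²` along the real axis at the
threshold `am − 2Mζ₀r₊ = 0`. In particular the zero of `𝔞∘P` at `ζ₀` is simple.
[cite: ShlapentokhRothman2014KleinGordon, §4.3 (Prop. 4.6 mechanism)] -/
theorem im_deriv_matchA_threshold (h : Kerr.IsSubextremal M a) {R g R₁ : ℝ} (hR : 0 ≤ R) (hg : 0 < g)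
    (hM : IsMatchRadius M a m R g R₁) {P : ℂ → ℂ × ℂ × ℂ} (hP : ContDiffAt ℂ 1 P (omega0 M a m : ℂ))
    {Lr : ℝ → ℝ} {σ : ℝ} (hPreal : ∀ᶠ ζ : ℝ in 𝓝 (omega0 M a m), P (ζ : ℂ) = ((ζ : ℂ), ((Lr ζ : ℝ) : ℂ), (σ : ℂ)))
    (hadm : IsAdmS R g (P (omega0 M a m : ℂ))) (hA0 : matchA M a m h (hM.le h hR hg) hg (P (omega0 M a m : ℂ)) = 0) :
    (deriv (fun ζ ↦ matchA M a m h (hM.le h hR hg) hg (P ζ)) (omega0 M a m : ℂ) *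
        conj (recY M a m h (hM.le h hR hg) hg (P (omega0 M a m : ℂ)) (R₁ + 1) * radY M a m (P (omega0 M a m : ℂ)) (R₁ + 1))).im =
      -(2 * M * Kerr.rPlus M a) * ‖recY M a m h (hM.le h hR hg) hg (P (omega0 M a m : ℂ)) (R₁ + 1)‖ ^ 2 := by
  set w₀ : ℝ := omega0 M a m with hw₀
  set t₁ : ℝ := R₁ + 1 with ht₁
  have ht₁r : Kerr.rPlus M a < t₁ := by simp only [ht₁]; linarith [hM.le h hR hg]
  have hP0 : P (w₀ : ℂ) = ((w₀ : ℂ), ((Lr w₀ : ℝ) : ℂ), (σ : ℂ)) := hPreal.self_of_nhds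
  have hgood : P (w₀ : ℂ) ∈ horGood M a := by
    apply mem_horGood_of_im_nonneg h; rw [hP0]; simp
  -- continuity of `ζ ↦ P ζ` at `w₀` along the reals, eventual admissibility
  have hPc : ContinuousAt (fun ζ : ℝ ↦ P (ζ : ℂ)) w₀ := hP.continuousAt.comp Complex.continuous_ofReal.continuousAt
  have hadm_ev : ∀ᶠ ζ : ℝ in 𝓝 w₀, IsAdmS R g (P (ζ : ℂ)) := hPc.preimage_mem_nhds ((isOpen_isAdmS R g).mem_nhds hadm)
  -- the complex derivatives
  have hFd := (differentiableAt_matchA_comp h hR hg hM hP hadm.isAdm hgood).hasDerivAt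
  set c := deriv (fun ζ ↦ matchA M a m h (hM.le h hR hg) hg (P ζ)) (w₀ : ℂ) with hc
  have hFr : HasDerivAt (fun ζ : ℝ ↦ matchA M a m h (hM.le h hR hg) hg (P (ζ : ℂ))) c w₀ := hFd.comp_ofReal
  obtain ⟨-, hw, -⟩ := norm_jostW_lt h hR hg hM hadm.isAdm
  have hwf : ContDiffAt ℂ 1 (fun κ ↦ jostW h m (hM.le h hR hg) g (P κ)) (w₀ : ℂ) :=
    (contDiff_jostW h m _ g).contDiffAt.comp (w₀ : ℂ) hP
  have hrec : DifferentiableAt ℂ (fun ζ ↦ recY M a m h (hM.le h hR hg) hg (P ζ) t₁) (w₀ : ℂ) :=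
    (contDiffAt_jostY_param (gam1_nonneg g) (gam1_lt hg) R₁ hwf hw t₁).differentiableAt one_ne_zero
  obtain ⟨hradY, -⟩ := differentiableAt_radY_comp (m := m) h (hP.differentiableAt one_ne_zero) hgood (t := t₁) ht₁r
  set N : ℂ → ℂ := fun ζ ↦ recY M a m h (hM.le h hR hg) hg (P ζ) t₁ * radY M a m (P ζ) t₁ with hN
  have hNd : HasDerivAt N (deriv N (w₀ : ℂ)) (w₀ : ℂ) := (hrec.mul hradY).hasDerivAt
  set d := deriv N (w₀ : ℂ) with hd
  have hNr : HasDerivAt (fun ζ : ℝ ↦ N (ζ : ℂ)) d w₀ := hNd.comp_ofReal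
  have hNc : HasDerivAt (fun ζ : ℝ ↦ conj (N (ζ : ℂ))) (conj d) w₀ := by
    simpa only [starRingEnd_apply] using hNr.star
  -- the product and its imaginary part
  have hG := hFr.mul hNc
  have hGim : HasDerivAt (fun ζ : ℝ ↦ (matchA M a m h (hM.le h hR hg) hg (P (ζ : ℂ)) * conj (N (ζ : ℂ))).im)
      ((c * conj (N (w₀ : ℂ)) + matchA M a m h (hM.le h hR hg) hg (P (w₀ : ℂ)) * conj d).im) w₀ := by
    have h1 := Complex.imCLM.hasFDerivAt.comp_hasDerivAt w₀ hG
    simpa [Function.comp_def] using h1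
  -- the right-hand side and its derivative
  set y₀ := recY M a m h (hM.le h hR hg) hg (P (w₀ : ℂ)) t₁ with hy₀
  have hrecR : HasDerivAt (fun ζ : ℝ ↦ recY M a m h (hM.le h hR hg) hg (P (ζ : ℂ)) t₁)
      (deriv (fun ζ ↦ recY M a m h (hM.le h hR hg) hg (P ζ) t₁) (w₀ : ℂ)) w₀ := hrec.hasDerivAt.comp_ofReal
  have hnsq := hasDerivAt_normSq hrecR
  have hlin : HasDerivAt (fun ζ : ℝ ↦ a * m - 2 * M * ζ * Kerr.rPlus M a) (-(2 * M * Kerr.rPlus M a)) w₀ := by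
    have := ((hasDerivAt_id w₀).const_mul (2 * M)).mul_const (Kerr.rPlus M a)
    have := (hasDerivAt_const w₀ (a * m)).sub this
    exact this.congr_deriv (by simp)
  have hH := hlin.mul hnsq
  -- the two functions agree near `w₀`
  have hev : ∀ᶠ ζ : ℝ in 𝓝 w₀, (matchA M a m h (hM.le h hR hg) hg (P (ζ : ℂ)) * conj (N (ζ : ℂ))).im =
      (a * m - 2 * M * ζ * Kerr.rPlus M a) * ‖recY M a m h (hM.le h hR hg) hg (P (ζ : ℂ)) t₁‖ ^ 2 := by
    filter_upwards [hPreal, hadm_ev] with ζ hζ hadmζ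
    have hadm' : IsAdm R g ((ζ : ℂ), ((Lr ζ : ℝ) : ℂ), (σ : ℂ)) := by rw [← hζ]; exact hadmζ.isAdm
    have := im_matchA_mul_conj h hR hg hM ζ (Lr ζ) σ hadm'
    simp only [hN, hζ]
    exact this
  have h2 := (hGim.congr_of_eventuallyEq (hev.mono fun ζ hζ ↦ hζ.symm)).unique hH
  -- evaluate at the threshold: `𝔞 = 0` and `am − 2Mζ₀r₊ = 0`
  rw [hA0, zero_mul, add_zero] at h2
  rw [h2, am_sub_omega0 h]
  ring

end DerivIdentity


/-! ### The angular branch as a function of the mass, at threshold -/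

section Level

variable {M a : ℝ} {m : ℤ}

/-- `ω₀ ≠ 0` for `a ≠ 0`, `m ≠ 0`. [folklore] -/
theorem omega0_ne_zero (h : Kerr.IsSubextremal M a) (ha : a ≠ 0) (hm : m ≠ 0) : omega0 M a m ≠ 0 := by
  have hM := h.pos
  have hr := rPlus_pos_of_isSubextremal h
  unfold omega0
  have hm' : (m : ℝ) ≠ 0 := by exact_mod_cast hm
  exact div_ne_zero (mul_ne_zero ha hm') (by positivity)

/-- `|ω₀| = |am|/(2Mr₊)`. [folklore] -/
theorem abs_omega0 (h : Kerr.IsSubextremal M a) : |omega0 M a m| = |a * m| / (2 * M * Kerr.rPlus M a) := by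
  have hM := h.pos
  have hr := rPlus_pos_of_isSubextremal h
  rw [omega0, abs_div, abs_of_pos (by positivity : (0 : ℝ) < 2 * M * Kerr.rPlus M a)]

variable (M a m) in
/-- **The mass-parametrised angular eigenvalue at threshold**: `Λ(μ) = γ(clamp(a²(ω₀² − μ²))) + m₀(m₀+1)`
for a real branch `γ` on `[−K, 0]`, `m₀ = |m|`. [cite: ShlapentokhRothman2014KleinGordon, App. B] -/
def LamOf (γ : ℝ → ℝ) (K : ℝ) (μ : ℝ) : ℝ :=
  γ (max (-K) (min (a ^ 2 * (omega0 M a m ^ 2 - μ ^ 2)) 0)) + (m.natAbs : ℝ) * ((m.natAbs : ℝ) + 1)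

/-- The clamp lands in `[−K, 0]`. [folklore] -/
theorem clamp_mem {K : ℝ} (hK : 0 ≤ K) (x : ℝ) : max (-K) (min x 0) ∈ Icc (-K) 0 :=
  ⟨le_max_left _ _, max_le (by linarith) (min_le_right _ _)⟩

/-- The clamp is the identity on `[−K, 0]`. [folklore] -/
theorem clamp_eq {K x : ℝ} (hx : x ∈ Icc (-K) 0) : max (-K) (min x 0) = x := by
  rw [min_eq_left hx.2, max_eq_right hx.1]

/-- `Λ` is continuous. [folklore] -/
theorem continuous_LamOf {γ : ℝ → ℝ} {K : ℝ} (hK : 0 ≤ K) (hγ : ContinuousOn γ (Icc (-K) 0)) :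
    Continuous (LamOf M a m γ K) := by
  unfold LamOf
  refine Continuous.add ?_ continuous_const
  exact hγ.comp_continuous (by fun_prop) fun μ ↦ clamp_mem hK _

/-- `Λ` is non-decreasing in `μ ≥ 0` (`γ` antitone). [folklore] -/
theorem LamOf_mono {γ : ℝ → ℝ} {K : ℝ} (hK : 0 ≤ K) (hγ : AntitoneOn γ (Icc (-K) 0)) {μ μ' : ℝ} (h0 : 0 ≤ μ)
    (hle : μ ≤ μ') : LamOf M a m γ K μ ≤ LamOf M a m γ K μ' := by
  unfold LamOf
  gcongr ?_ + _
  refine hγ (clamp_mem hK _) (clamp_mem hK _) ?_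
  have : a ^ 2 * (omega0 M a m ^ 2 - μ' ^ 2) ≤ a ^ 2 * (omega0 M a m ^ 2 - μ ^ 2) := by
    apply mul_le_mul_of_nonneg_left _ (sq_nonneg a); nlinarith
  exact max_le_max le_rfl (min_le_min this le_rfl)

/-- On the branch range, `Λ(μ) = γ(a²(ω₀² − μ²)) + m₀(m₀+1)`. [folklore] -/
theorem LamOf_eq {γ : ℝ → ℝ} {K μ : ℝ} (hκ : a ^ 2 * (omega0 M a m ^ 2 - μ ^ 2) ∈ Icc (-K) 0) :
    LamOf M a m γ K μ = γ (a ^ 2 * (omega0 M a m ^ 2 - μ ^ 2)) + (m.natAbs : ℝ) * ((m.natAbs : ℝ) + 1) := by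
  rw [LamOf, clamp_eq hκ]

/-- The a priori lower bound `Λ(μ) ≥ ν₀ + m₀(m₀+1) − a²(μ² − ω₀²)` on the branch range. [folklore] -/
theorem LamOf_ge {ν₀ : ℝ} {γ : ℝ → ℝ} {K μ : ℝ} (hB : IsGlobalBranch m.natAbs ν₀ γ (-K))
    (hκ : a ^ 2 * (omega0 M a m ^ 2 - μ ^ 2) ∈ Icc (-K) 0) :
    ν₀ + (m.natAbs : ℝ) * ((m.natAbs : ℝ) + 1) - a ^ 2 * (μ ^ 2 - omega0 M a m ^ 2) ≤ LamOf M a m γ K μ := by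
  rw [LamOf_eq hκ]
  have hb := hB.bound _ hκ
  have : |a ^ 2 * (omega0 M a m ^ 2 - μ ^ 2)| = a ^ 2 * (μ ^ 2 - omega0 M a m ^ 2) := by
    rw [abs_of_nonpos hκ.2]; ring
  rw [this] at hb
  have := (abs_le.1 hb).1
  linarith

/-- `√(u + v) ≤ √u + √v`. [folklore] -/
theorem sqrt_add_le' {u v : ℝ} (hu : 0 ≤ u) (hv : 0 ≤ v) : Real.sqrt (u + v) ≤ Real.sqrt u + Real.sqrt v := by
  rw [Real.sqrt_le_left (by positivity)]
  have h1 := Real.sq_sqrt hu; have h2 := Real.sq_sqrt hv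
  nlinarith [Real.sqrt_nonneg u, Real.sqrt_nonneg v]

/-- **No zeros for large mass**: if `Λ` obeys the branch lower bound at level `L = ν₀ + m₀(m₀+1)` and
`x = μ² − ω₀² ≥ M²ω₀⁴/(κ₀(L − 4M²ω₀²))`, `κ₀ = 1 − a²/r₊²`, then `V ≥ 0`, so `z(·; Λ(μ), μ²) > 0`
on `(r₊, ∞)`. [cite: ShlapentokhRothman2014KleinGordon, §4.2] -/
theorem thrZ_pos_of_large {ν₀ : ℝ} {γ : ℝ → ℝ} {K μ : ℝ} (h : Kerr.IsSubextremal M a)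
    (hB : IsGlobalBranch m.natAbs ν₀ γ (-K)) (hκ : a ^ 2 * (omega0 M a m ^ 2 - μ ^ 2) ∈ Icc (-K) 0)
    (hx : 0 < μ ^ 2 - omega0 M a m ^ 2)
    (hx0 : M ^ 2 * omega0 M a m ^ 4 ≤ (1 - a ^ 2 / Kerr.rPlus M a ^ 2) *
      (ν₀ + (m.natAbs : ℝ) * ((m.natAbs : ℝ) + 1) - 4 * M ^ 2 * omega0 M a m ^ 2) * (μ ^ 2 - omega0 M a m ^ 2)) :
    ∀ t ∈ Ioi (Kerr.rPlus M a), 0 < thrZ M a m (LamOf M a m γ K μ) (μ ^ 2) t := by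
  have hrp := rPlus_pos_of_isSubextremal h
  have har : a ^ 2 < Kerr.rPlus M a ^ 2 := by
    have h1 : |a| < M := h
    have h2 : M < Kerr.rPlus M a := by
      have : Kerr.rPlus M a = M + Real.sqrt (M ^ 2 - a ^ 2) := rfl
      have hs : 0 < Real.sqrt (M ^ 2 - a ^ 2) := Real.sqrt_pos.2 (by nlinarith [abs_nonneg a, sq_abs a])
      linarith
    have : |a| < Kerr.rPlus M a := h1.trans h2
    nlinarith [abs_nonneg a, sq_abs a]
  set κ₀ := 1 - a ^ 2 / Kerr.rPlus M a ^ 2 with hκ₀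
  have hκ₀pos : 0 < κ₀ := by
    rw [hκ₀, sub_pos, div_lt_one (by positivity)]; exact har
  set x := μ ^ 2 - omega0 M a m ^ 2 with hx_def
  set L := ν₀ + (m.natAbs : ℝ) * ((m.natAbs : ℝ) + 1) with hL_def
  have hLam := LamOf_ge (M := M) (a := a) hB hκ
  refine thrZ_pos_of_thrV_nonneg h fun r hr ↦ thrV_nonneg h (fun r hr ↦ ?_) hr.le
  -- the quadratic bound
  have hr0 : 0 < r := hrp.trans_le hr
  have hr2 : Kerr.rPlus M a ^ 2 ≤ r ^ 2 := by nlinarith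
  have hax : a ^ 2 * x ≤ a ^ 2 * x * r ^ 2 / Kerr.rPlus M a ^ 2 := by
    rw [le_div_iff₀ (by positivity)]
    exact mul_le_mul_of_nonneg_left hr2 (mul_nonneg (sq_nonneg a) hx.le)
  have hkey : 0 ≤ κ₀ * x * r ^ 2 - 2 * M * omega0 M a m ^ 2 * r + (L - 4 * M ^ 2 * omega0 M a m ^ 2) := by
    have hcx : 0 < κ₀ * x := mul_pos hκ₀pos hx
    nlinarith [sq_nonneg (κ₀ * x * r - M * omega0 M a m ^ 2), hx0]
  have hexp : κ₀ * x * r ^ 2 = x * r ^ 2 - a ^ 2 * x * r ^ 2 / Kerr.rPlus M a ^ 2 := by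
    rw [hκ₀]; field_simp
  nlinarith [hLam, hax, hkey, hexp]

end Level


/-! ### The holomorphic parameter curve `ω ↦ (ω, Λ(ω, μ), μ²)` -/

section Curve

variable {M a : ℝ} {m : ℤ}

/-- The parameter curve `P_μ(ω) = (ω, g(a²(ω² − μ²)) + m₀(m₀+1), μ²)` for a complex branch `g`. [folklore] -/
def curveP (a : ℝ) (m : ℤ) (gx : ℂ → ℂ) (μ : ℝ) (z : ℂ) : ℂ × ℂ × ℂ :=
  (z, gx (kapOf a z μ) + (m.natAbs : ℂ) * ((m.natAbs : ℂ) + 1), ((μ ^ 2 : ℝ) : ℂ))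

/-- `P_μ` is `C¹` where the branch is. [folklore] -/
theorem contDiffAt_curveP {gx : ℂ → ℂ} {μ : ℝ} {z : ℂ} (hg : ContDiffAt ℂ 1 gx (kapOf a z μ)) :
    ContDiffAt ℂ 1 (curveP a m gx μ) z := by
  have hk : ContDiffAt ℂ 1 (fun z ↦ kapOf a z μ) z := by unfold kapOf; fun_prop
  unfold curveP
  exact contDiffAt_id.prodMk (((hg.comp z hk).add contDiffAt_const).prodMk contDiffAt_const)

/-- Continuity of `(z, μ) ↦ P_μ(z)` where the branch is continuous. [folklore] -/
theorem continuousAt_curveP {gx : ℂ → ℂ} {q : ℂ × ℝ} (hg : ContinuousAt gx (kapOf a q.1 q.2)) :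
    ContinuousAt (fun q : ℂ × ℝ ↦ curveP a m gx q.2 q.1) q := by
  have hk : ContinuousAt (fun q : ℂ × ℝ ↦ kapOf a q.1 q.2) q := (continuous_kapOf a).continuousAt
  unfold curveP
  have hgk : ContinuousAt (fun q : ℂ × ℝ ↦ gx (kapOf a q.1 q.2)) q :=
    ContinuousAt.comp (g := gx) (f := fun q : ℂ × ℝ ↦ kapOf a q.1 q.2) (x := q) hg hk
  exact continuousAt_fst.prodMk ((hgk.add continuousAt_const).prodMk
    (Complex.continuous_ofReal.comp (continuous_snd.pow 2)).continuousAt)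

/-- On the real axis the curve is the real triple `(x, γ(a²(x² − μ²)) + m₀(m₀+1), μ²)`. [folklore] -/
theorem curveP_ofReal {gx : ℂ → ℂ} {γ : ℝ → ℝ} {μ x : ℝ}
    (hgr : gx (((a ^ 2 * (x ^ 2 - μ ^ 2) : ℝ)) : ℂ) = ((γ (a ^ 2 * (x ^ 2 - μ ^ 2)) : ℝ) : ℂ)) :
    curveP a m gx μ (x : ℂ) = ((x : ℂ), ((γ (a ^ 2 * (x ^ 2 - μ ^ 2)) + (m.natAbs : ℝ) * ((m.natAbs : ℝ) + 1) : ℝ) : ℂ),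
      ((μ ^ 2 : ℝ) : ℂ)) := by
  unfold curveP
  rw [kapOf_ofReal, hgr]
  push_cast
  ring_nf

/-- `im(U/c) = im(U conj c)/‖c‖²`. [folklore] -/
theorem im_div_eq_im_mul_conj (U c : ℂ) : (U / c).im = (U * conj c).im / ‖c‖ ^ 2 := by
  rw [Complex.div_im, Complex.mul_im, Complex.conj_re, Complex.conj_im, Complex.normSq_eq_norm_sq]; ring

/-- **The local complex branch and its neighbourhood.** For a global real branch `γ` on `[−K, 0]`
and an interior point `κ*`, there are `g : ℂ → ℂ` and `ε > 0` with: `F(g κ, κ) = 0` and `g` is `C¹`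
(over `ℂ`) on the ball `|κ − κ*| < ε`; `g = γ` on real `κ` with `|κ − κ*| < ε`, all of which lie in
`[−K, 0]`. [cite: ShlapentokhRothman2014KleinGordon, App. B Prop. B.1] -/
theorem exists_local_complex_branch {ν₀ : ℝ} {γ : ℝ → ℝ} {K κs : ℝ} (hB : IsGlobalBranch m.natAbs ν₀ γ (-K))
    (hκs : κs ∈ Ioo (-K) 0) :
    ∃ (gx : ℂ → ℂ) (ε : ℝ), 0 < ε ∧
      (∀ κ ∈ ball (κs : ℂ) ε, sphmShoot m.natAbs (gx κ, κ) = 0 ∧ ContDiffAt ℂ 1 gx κ) ∧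
      (∀ κ : ℝ, |κ - κs| < ε → gx (κ : ℂ) = ((γ κ : ℝ) : ℂ) ∧ κ ∈ Icc (-K) 0) := by
  obtain ⟨gx, -, hzero, hdiff, huniq⟩ := hB.exists_holomorphic_extension hκs
  obtain ⟨ε₁, hε₁, h₁⟩ := Metric.eventually_nhds_iff.1 (hzero.and hdiff)
  obtain ⟨ε₂, hε₂, h₂⟩ := Metric.eventually_nhds_iff.1 huniq
  set ε₃ : ℝ := min (κs + K) (-κs) with hε₃
  have hε₃0 : 0 < ε₃ := lt_min (by linarith [hκs.1]) (by linarith [hκs.2])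
  set ε := min ε₁ (min ε₂ ε₃) with hε
  have hε0 : 0 < ε := lt_min hε₁ (lt_min hε₂ hε₃0)
  have hdiffOn : DifferentiableOn ℂ gx (ball (κs : ℂ) ε₁) := fun κ hκ ↦ (h₁ hκ).2.differentiableWithinAt
  have hcd : ContDiffOn ℂ 1 gx (ball (κs : ℂ) ε₁) := hdiffOn.contDiffOn isOpen_ball
  refine ⟨gx, ε, hε0, fun κ hκ ↦ ?_, fun κ hκ ↦ ?_⟩
  · have hκ₁ : κ ∈ ball (κs : ℂ) ε₁ := ball_subset_ball (min_le_left _ _) hκ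
    exact ⟨(h₁ hκ₁).1, hcd.contDiffAt (isOpen_ball.mem_nhds hκ₁)⟩
  · have hκ₂ : dist κ κs < ε₂ := lt_of_lt_of_le hκ ((min_le_right _ _).trans (min_le_left _ _))
    have hκ₃ : |κ - κs| < ε₃ := lt_of_lt_of_le hκ ((min_le_right _ _).trans (min_le_right _ _))
    refine ⟨h₂ hκ₂, ?_, ?_⟩
    · have := (abs_lt.1 hκ₃).1; have := min_le_left (κs + K) (-κs); linarith
    · have := (abs_lt.1 hκ₃).2; have := min_le_right (κs + K) (-κs); linarith

end Curve

/-! ### The unstable modes -/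

section Final

variable {M a : ℝ} {m : ℤ}

/-- **Smallness of `a|ω|` near the threshold frequency**: if `‖ω − ω₀‖ ≤ |ω₀|/2`
(`ω₀ = am/(2Mr₊)`), then `a²‖ω‖² ≤ |m|(|m|+1)` — indeed `‖ω‖ ≤ 3|ω₀|/2` and `2|a||ω₀| ≤ |m|`
because `2Mr₊ = r₊² + a² > 2a²` (`|a| < M < r₊`). This is the hypothesis of the angular input
`im_angular_mul_conj_neg`. [folklore] -/
theorem sq_norm_le_of_near_omega0 (h : Kerr.IsSubextremal M a) {z : ℂ}
    (hz : ‖z - (omega0 M a m : ℂ)‖ ≤ |omega0 M a m| / 2) :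
    a ^ 2 * ‖z‖ ^ 2 ≤ (m.natAbs : ℝ) * ((m.natAbs : ℝ) + 1) := by
  have hrp := rPlus_pos_of_isSubextremal h
  have hMpos := h.pos
  have hq0 : 0 < 2 * M * Kerr.rPlus M a := by positivity
  -- `2Mr₊ = r₊² + a² > 2a²`
  have hq : 2 * M * Kerr.rPlus M a = Kerr.rPlus M a ^ 2 + a ^ 2 := by
    rw [← Kerr.rPlus_mul_rMinus h.le, sq, ← mul_add, Kerr.rPlus_add_rMinus]; ring
  have har : a ^ 2 < Kerr.rPlus M a ^ 2 := by
    have h1 : |a| < M := h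
    have h2 : M < Kerr.rPlus M a := by
      have : Kerr.rPlus M a = M + Real.sqrt (M ^ 2 - a ^ 2) := rfl
      have hs : 0 < Real.sqrt (M ^ 2 - a ^ 2) := Real.sqrt_pos.2 (by nlinarith [abs_nonneg a, sq_abs a])
      linarith
    have : |a| < Kerr.rPlus M a := h1.trans h2
    nlinarith [abs_nonneg a, sq_abs a]
  have h2a : 2 * a ^ 2 < 2 * M * Kerr.rPlus M a := by rw [hq]; linarith [har]
  set w₀ : ℝ := omega0 M a m with hw₀
  set m₀ : ℕ := m.natAbs with hm₀
  have hm₀R : ((m₀ : ℝ)) = |(m : ℝ)| := by rw [hm₀, Nat.cast_natAbs, Int.cast_abs]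
  have hm₀0 : 0 ≤ (m₀ : ℝ) := Nat.cast_nonneg _
  -- `|ω₀| · 2Mr₊ = |a| m₀`, hence `2|a||ω₀| ≤ m₀`
  have hw₀q : |w₀| * (2 * M * Kerr.rPlus M a) = |a| * (m₀ : ℝ) := by
    rw [hw₀, abs_omega0 h, hm₀R, ← abs_mul, div_mul_cancel₀ _ hq0.ne']
  have h3 : 2 * |a| * |w₀| ≤ (m₀ : ℝ) := by
    have : 2 * |a| * |w₀| * (2 * M * Kerr.rPlus M a) ≤ (m₀ : ℝ) * (2 * M * Kerr.rPlus M a) :=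
      calc 2 * |a| * |w₀| * (2 * M * Kerr.rPlus M a) = 2 * |a| * (|w₀| * (2 * M * Kerr.rPlus M a)) := by ring
        _ = 2 * a ^ 2 * (m₀ : ℝ) := by rw [hw₀q, ← sq_abs a]; ring
        _ ≤ (2 * M * Kerr.rPlus M a) * (m₀ : ℝ) := mul_le_mul_of_nonneg_right h2a.le hm₀0
        _ = (m₀ : ℝ) * (2 * M * Kerr.rPlus M a) := by ring
    exact le_of_mul_le_mul_right this hq0
  -- `‖ω‖ ≤ 3|ω₀|/2`, so `|a|‖ω‖ ≤ 3m₀/4`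
  have h4 : ‖z‖ ≤ 3 / 2 * |w₀| :=
    calc ‖z‖ = ‖(z - (w₀ : ℂ)) + (w₀ : ℂ)‖ := by rw [sub_add_cancel]
      _ ≤ ‖z - (w₀ : ℂ)‖ + ‖(w₀ : ℂ)‖ := norm_add_le _ _
      _ ≤ |w₀| / 2 + |w₀| := by rw [Complex.norm_real, Real.norm_eq_abs]; exact add_le_add hz le_rfl
      _ = 3 / 2 * |w₀| := by ring
  have h6 : |a| * ‖z‖ ≤ 3 / 4 * (m₀ : ℝ) :=
    calc |a| * ‖z‖ ≤ |a| * (3 / 2 * |w₀|) := mul_le_mul_of_nonneg_left h4 (abs_nonneg a)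
      _ = 3 / 4 * (2 * |a| * |w₀|) := by ring
      _ ≤ 3 / 4 * (m₀ : ℝ) := by linarith only [h3]
  have h7 : a ^ 2 * ‖z‖ ^ 2 = (|a| * ‖z‖) ^ 2 := by rw [mul_pow, sq_abs]
  rw [h7]
  have h8 : 0 ≤ |a| * ‖z‖ := by positivity
  nlinarith [h6, h8, hm₀0]

/-- **The superradiant unstable mode data near the threshold mass** — the content of SR's
Theorem 1.2 read at one small `ε > 0`, i.e. all clauses of `ShlapentokhRothman2014_separatedMode`:
for sub-extremal `(M, a)` with `a ≠ 0`, `m ≠ 0` and every `δ > 0` there are a mass `μ` within `δ`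
of `|am|/(2Mr₊)` and a frequency `ω` with `Im ω > 0`, `Re ω ≠ 0`, `2Mr₊|ω| < |am|`, carrying
separated mode data. Proof: real threshold bound state by shooting in `μ` at a high angular level
(`KleinGordonRealModes`), matching function and current identity (`KleinGordonMatching`),
simplicity of the threshold zero (`im_deriv_matchA_threshold`), persistence of the zero
(`SimpleZeroPerturbation`) with the sign of `Im ω` read off from the Sturm structure below the
bound state (`wronskian_thr_neg`), and superradiance by Prop. 4.6 (`superradiant_mdR_of_zero`; the
perturbed frequency stays within `|ω₀|/2` of `ω₀ = am/(2Mr₊)`, whence `a²|ω|² ≤ (9/16)m²`).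
[cite: ShlapentokhRothman2014KleinGordon, Thm. 1.2, §4 and Prop. 4.6] -/
theorem exists_superradiant_mode_data (h : Kerr.IsSubextremal M a) (ha : a ≠ 0) (hm : m ≠ 0) {δ : ℝ} (hδ : 0 < δ) :
    ∃ μ > (0 : ℝ), |μ - |a * m| / (2 * M * Kerr.rPlus M a)| < δ ∧
      ∃ w : ℂ, 0 < w.im ∧ w.re ≠ 0 ∧ 2 * M * Kerr.rPlus M a * ‖w‖ < |a * m| ∧
      ∃ (Λ : ℂ) (S : ℝ → ℂ) (Y : E3 → ℂ),
        IsAngularSolution a w μ m Λ S ∧ IsSphericalExtension m S Y ∧ (∃ θ ∈ Ioo 0 Real.pi, S θ ≠ 0) ∧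
        ∃ R f : ℝ → ℂ, IsRadialSolution M a w m Λ μ R ∧
          (∃ η > (0 : ℝ), ContDiffOn ℝ ∞ f (Ioi (Kerr.rPlus M a - η))) ∧
          (∀ r ∈ Ioi (Kerr.rPlus M a),
            R r = Complex.exp (-(Complex.I * (w * ((Kerr.starTime M a r : ℝ) : ℂ) -
              (m : ℂ) * ((Kerr.starAngle M a r : ℝ) : ℂ)))) * f r) ∧
          (∃ r ∈ Ioi (Kerr.rPlus M a), R r ≠ 0) ∧
          ∃ C κ : ℝ, 0 < κ ∧ ∀ r : ℝ, Kerr.rPlus M a + 1 ≤ r →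
            ‖R r‖ ≤ C * Real.exp (-(κ * r)) ∧ ‖deriv R r‖ ≤ C * Real.exp (-(κ * r)) := by
  ------------------------------------------------------------------
  -- Step 0: constants
  ------------------------------------------------------------------
  have hrp := rPlus_pos_of_isSubextremal h
  have hMpos := h.pos
  set w₀ : ℝ := omega0 M a m with hw₀
  have hw₀ne : w₀ ≠ 0 := omega0_ne_zero h ha hm
  have hw₀abs : 0 < |w₀| := abs_pos.2 hw₀ne
  have ha2 : 0 < a ^ 2 := by positivity
  set m₀ : ℕ := m.natAbs with hm₀
  set cm : ℝ := (m₀ : ℝ) * ((m₀ : ℝ) + 1) with hcm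
  have hcm0 : 0 ≤ cm := by positivity
  -- `κ₀ = 1 − a²/r₊² > 0`
  have har : a ^ 2 < Kerr.rPlus M a ^ 2 := by
    have h1 : |a| < M := h
    have h2 : M < Kerr.rPlus M a := by
      have : Kerr.rPlus M a = M + Real.sqrt (M ^ 2 - a ^ 2) := rfl
      have hs : 0 < Real.sqrt (M ^ 2 - a ^ 2) := Real.sqrt_pos.2 (by nlinarith [abs_nonneg a, sq_abs a])
      linarith
    have : |a| < Kerr.rPlus M a := h1.trans h2
    nlinarith [abs_nonneg a, sq_abs a]
  set κ₀ : ℝ := 1 - a ^ 2 / Kerr.rPlus M a ^ 2 with hκ₀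
  have hκ₀pos : 0 < κ₀ := by rw [hκ₀, sub_pos, div_lt_one (by positivity)]; exact har
  ------------------------------------------------------------------
  -- Step 1: the level `n` (even, large) and the target `x₀`
  ------------------------------------------------------------------
  set xt : ℝ := min 1 (δ ^ 2 / 4) with hxt
  have hxt0 : 0 < xt := lt_min one_pos (by positivity)
  have hxt1 : xt ≤ 1 := min_le_left _ _
  have hxtδ : xt ≤ δ ^ 2 / 4 := min_le_right _ _
  set Q : ℝ := M ^ 2 * w₀ ^ 4 / (κ₀ * xt) + 4 * M ^ 2 * w₀ ^ 2 + 1 with hQ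
  have hQ1 : 0 ≤ M ^ 2 * w₀ ^ 4 / (κ₀ * xt) := by positivity
  set n : ℕ := 2 * ⌈Q⌉₊ with hn
  have hn_even : Even n := ⟨⌈Q⌉₊, by rw [hn]; ring⟩
  have hnQ : Q ≤ (n : ℝ) := by
    have h1 := Nat.le_ceil Q
    have h2 : ((⌈Q⌉₊ : ℕ) : ℝ) ≤ (n : ℝ) := by
      rw [hn]; push_cast; linarith only [Nat.cast_nonneg (α := ℝ) ⌈Q⌉₊]
    exact h1.trans h2
  set ν₀ : ℝ := (legNu m₀ n).re with hν₀
  have hν₀e : ν₀ = (n : ℝ) * ((n : ℝ) + 2 * (m₀ : ℝ) + 1) := by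
    rw [hν₀, legNu]; simp [Complex.mul_re]
  have hν₀n : (n : ℝ) ≤ ν₀ := by
    rw [hν₀e]
    have h0 : (0 : ℝ) ≤ n := Nat.cast_nonneg n
    have h1 : (1 : ℝ) ≤ (n : ℝ) + 2 * (m₀ : ℝ) + 1 := by linarith only [h0, Nat.cast_nonneg (α := ℝ) m₀]
    nlinarith only [h0, h1]
  set L : ℝ := ν₀ + cm with hL
  have hLQ : Q ≤ L := hnQ.trans (hν₀n.trans (by linarith only [hcm0]))
  have hLpos : 0 < L - 4 * M ^ 2 * w₀ ^ 2 := by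
    have : Q ≤ L := hLQ; rw [hQ] at this; linarith only [this, hQ1]
  have hL4 : M ^ 2 * w₀ ^ 4 / (κ₀ * xt) ≤ L - 4 * M ^ 2 * w₀ ^ 2 := by
    have : Q ≤ L := hLQ; rw [hQ] at this; linarith only [this]
  set x₀ : ℝ := M ^ 2 * w₀ ^ 4 / (κ₀ * (L - 4 * M ^ 2 * w₀ ^ 2)) with hx₀
  have hx₀pos : 0 < x₀ := by positivity
  have hx₀xt : x₀ ≤ xt := by
    rw [hx₀, div_le_iff₀ (by positivity)]
    rw [div_le_iff₀ (by positivity)] at hL4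
    have : xt * (κ₀ * (L - 4 * M ^ 2 * w₀ ^ 2)) = (L - 4 * M ^ 2 * w₀ ^ 2) * (κ₀ * xt) := by ring
    rw [this]; exact hL4
  ------------------------------------------------------------------
  -- Step 2: the branch and the family
  ------------------------------------------------------------------
  set K : ℝ := a ^ 2 * (2 * |w₀| + 2) with hK
  have hK0 : 0 ≤ K := by positivity
  obtain ⟨γ, hB, hγanti, -⟩ := exists_eigenvalue_branch m₀ hn_even hK0
  set Lam : ℝ → ℝ := LamOf M a m γ K with hLam
  have hLamc : Continuous Lam := continuous_LamOf hK0 hB.continuousOn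
  have hrange : ∀ μ : ℝ, w₀ ^ 2 ≤ μ ^ 2 → μ ^ 2 ≤ w₀ ^ 2 + 1 → a ^ 2 * (w₀ ^ 2 - μ ^ 2) ∈ Icc (-K) 0 := by
    intro μ h1 h2
    have h3 := mul_le_mul_of_nonneg_left h2 ha2.le
    have h4 : 0 ≤ a ^ 2 * |w₀| := by positivity
    constructor
    · rw [hK]; linarith only [h3, h4, ha2]
    · exact mul_nonpos_iff.2 (Or.inl ⟨ha2.le, by linarith only [h1]⟩)
  ------------------------------------------------------------------
  -- Step 3: `μb` — no zeros (`V ≥ 0`)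
  ------------------------------------------------------------------
  set μb : ℝ := Real.sqrt (w₀ ^ 2 + x₀) with hμb
  have hμb2 : μb ^ 2 = w₀ ^ 2 + x₀ := by rw [hμb]; exact Real.sq_sqrt (by positivity)
  have hμbpos : 0 < μb := by rw [hμb]; exact Real.sqrt_pos.2 (by positivity)
  have hκb : a ^ 2 * (w₀ ^ 2 - μb ^ 2) ∈ Icc (-K) 0 :=
    hrange μb (by rw [hμb2]; linarith only [hx₀pos]) (by rw [hμb2]; linarith only [hx₀xt, hxt1])
  have hb : ∀ t ∈ Ioi (Kerr.rPlus M a), thrZ M a m (Lam μb) ((μb ^ 2 : ℝ)) t ≠ 0 := by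
    intro t ht
    refine (thrZ_pos_of_large (M := M) (a := a) (μ := μb) h hB hκb (by rw [hμb2]; linarith only [hx₀pos]) ?_ t ht).ne'
    rw [hμb2, show w₀ ^ 2 + x₀ - w₀ ^ 2 = x₀ by ring, hx₀]
    have hκ₀ne := hκ₀pos.ne'
    have hLne := hLpos.ne'
    rw [← hκ₀, ← hw₀, ← hcm, ← hL]
    have heq : κ₀ * (L - 4 * M ^ 2 * w₀ ^ 2) * (M ^ 2 * w₀ ^ 4 / (κ₀ * (L - 4 * M ^ 2 * w₀ ^ 2))) = M ^ 2 * w₀ ^ 4 := by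
      field_simp
    exact le_of_eq heq.symm
  ------------------------------------------------------------------
  -- Step 4: `μa` — a zero (Sturm window)
  ------------------------------------------------------------------
  obtain ⟨Lmax, hLmax⟩ : ∃ Lmax, ∀ μ ∈ Icc (0 : ℝ) (|w₀| + 1), |Lam μ| ≤ Lmax := by
    obtain ⟨Lm, hLm⟩ := isCompact_Icc.exists_bound_of_continuousOn (hLamc.continuousOn (s := Icc (0 : ℝ) (|w₀| + 1)))
    exact ⟨Lm, fun μ hμ ↦ by simpa [Real.norm_eq_abs] using hLm μ hμ⟩
  obtain ⟨A, εz, hA, hεz, hzero⟩ := exists_zero_thrZ_of_small (m := m) h hw₀ne Lmax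
  set xa : ℝ := min εz x₀ with hxa
  have hxa0 : 0 < xa := lt_min hεz hx₀pos
  have hxax : xa ≤ x₀ := min_le_right _ _
  have hxaε : xa ≤ εz := min_le_left _ _
  set μa : ℝ := Real.sqrt (w₀ ^ 2 + xa) with hμa
  have hμa2 : μa ^ 2 = w₀ ^ 2 + xa := by rw [hμa]; exact Real.sq_sqrt (by positivity)
  have hμapos : 0 < μa := by rw [hμa]; exact Real.sqrt_pos.2 (by positivity)
  have hw₀μa : |w₀| < μa := by
    rw [← Real.sqrt_sq_eq_abs, hμa]; exact Real.sqrt_lt_sqrt (sq_nonneg _) (by linarith only [hxa0])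
  have hab : μa ≤ μb := by
    rw [hμa, hμb]; exact Real.sqrt_le_sqrt (by linarith only [hxax])
  have hμa1 : μa ≤ |w₀| + 1 := by
    rw [hμa, Real.sqrt_le_left (by positivity)]
    have hexp : (|w₀| + 1) ^ 2 = w₀ ^ 2 + 2 * |w₀| + 1 := by rw [add_sq, sq_abs]; ring
    rw [hexp]
    linarith only [hxax, hx₀xt, hxt1, abs_nonneg w₀]
  have hZa : ∃ t ∈ Ioi (Kerr.rPlus M a), thrZ M a m (Lam μa) ((μa ^ 2 : ℝ)) t = 0 := by
    obtain ⟨t, ht, ht0⟩ := hzero (Lam μa) ((μa ^ 2 : ℝ)) (hLmax μa ⟨hμapos.le, hμa1⟩) (by rw [hμa2]; linarith only [hxa0])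
      (by rw [hμa2]; linarith only [hxaε])
    exact ⟨t, lt_of_lt_of_le hA ht.1, ht0⟩
  have hZ : ∃ μ ∈ Icc μa μb, ∃ t ∈ Ioi (Kerr.rPlus M a), thrZ M a m (Lam μ) ((μ ^ 2 : ℝ)) t = 0 := ⟨μa, ⟨le_rfl, hab⟩, hZa⟩
  ------------------------------------------------------------------
  -- Step 5: the bound state `μs`
  ------------------------------------------------------------------
  obtain ⟨μs, hμsI, S, cq, Kq, -, hcq, hposS, -, ⟨Cd, hCd⟩, -⟩ := exists_threshold_boundState (m := m) h hLamc hw₀μa hZ hb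
  have hμsa : μa < μs := by
    rcases eq_or_lt_of_le hμsI.1 with heq | hlt
    · exfalso
      obtain ⟨t, ht, ht0⟩ := hZa
      rw [heq] at ht0
      exact (hposS t ht).ne' ht0
    · exact hlt
  have hμspos : 0 < μs := hμapos.trans hμsa
  have hw₀μs : |w₀| < μs := hw₀μa.trans hμsa
  have hgS : 0 < μs ^ 2 - w₀ ^ 2 := by
    have : |w₀| ^ 2 < μs ^ 2 := pow_lt_pow_left₀ hw₀μs (abs_nonneg _) two_ne_zero
    rw [sq_abs] at this; linarith only [this]
  have hμs2le : μs ^ 2 ≤ w₀ ^ 2 + x₀ := by rw [← hμb2]; exact pow_le_pow_left₀ hμspos.le hμsI.2 2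
  have hμsδ : μs < |w₀| + δ := by
    have h1 : μs ≤ Real.sqrt (w₀ ^ 2 + x₀) := by rw [← hμb]; exact hμsI.2
    have h2 : Real.sqrt (w₀ ^ 2 + x₀) ≤ |w₀| + Real.sqrt x₀ := by
      have := sqrt_add_le' (sq_nonneg w₀) hx₀pos.le; rwa [Real.sqrt_sq_eq_abs] at this
    have h3 : Real.sqrt x₀ < δ := by
      have : x₀ ≤ δ ^ 2 / 4 := hx₀xt.trans hxtδ
      calc Real.sqrt x₀ ≤ Real.sqrt (δ ^ 2 / 4) := Real.sqrt_le_sqrt this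
        _ = δ / 2 := by rw [show δ ^ 2 / 4 = (δ / 2) ^ 2 by ring, Real.sqrt_sq (by positivity)]
        _ < δ := by linarith only [hδ]
    linarith only [h1, h2, h3]
  have hdecS : ∃ S' C κ : ℝ, 0 < κ ∧ ∀ t : ℝ, S' ≤ t →
      |thrZ M a m (Lam μs) ((μs ^ 2 : ℝ)) t| ≤ C * Real.exp (-(κ * t)) ∧ |thrZ₁ M a m (Lam μs) ((μs ^ 2 : ℝ)) t| ≤ C * Real.exp (-(κ * t)) :=
    ⟨S + 1, Cd, Real.sqrt cq, Real.sqrt_pos.2 hcq, hCd⟩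
  ------------------------------------------------------------------
  -- Step 6: matching setup at `ps = (ω₀, Λs, μs²)`
  ------------------------------------------------------------------
  set gS : ℝ := μs ^ 2 - w₀ ^ 2 with hgS_def
  set Rb : ℝ := |w₀| + (|Lam μs| + 1) + (μs ^ 2 + 1) + 1 with hRb
  have hRb0 : 0 ≤ Rb := by positivity
  obtain ⟨R₁, hMR⟩ := exists_isMatchRadius (m := m) h hRb0 hgS
  have hR₁ : Kerr.rPlus M a + 1 ≤ R₁ := hMR.le h hRb0 hgS
  have ht₁m : R₁ + 1 ∈ Ioi R₁ := by rw [mem_Ioi]; exact lt_add_one R₁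
  have ht₁r : Kerr.rPlus M a < R₁ + 1 := by linarith only [hR₁, hrp]
  have hps_box : thrP M a m (Lam μs) ((μs ^ 2 : ℝ)) ∈ horBox Rb := by
    have hb := thrP_mem_horBox (M := M) (a := a) (m := m) (Λ := Lam μs) (σ := μs ^ 2) (L := |Lam μs| + 1)
      (L' := μs ^ 2 + 1) (lt_add_one _) (by rw [abs_of_nonneg (sq_nonneg μs)]; exact lt_add_one _)
      (by positivity) (by positivity)
    exact hb
  have hps_admS : IsAdmS Rb gS (thrP M a m (Lam μs) ((μs ^ 2 : ℝ))) := by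
    refine ⟨hps_box, ?_⟩
    have : ((thrP M a m (Lam μs) ((μs ^ 2 : ℝ))).2.2 - (thrP M a m (Lam μs) ((μs ^ 2 : ℝ))).1 ^ 2) - (gS : ℂ) = 0 := by
      simp only [thrP_snd_snd, thrP_fst, hgS_def]; push_cast; ring
    rw [this, norm_zero]; positivity
  ------------------------------------------------------------------
  -- Step 7: the complex branch and the curve
  ------------------------------------------------------------------
  set κs : ℝ := a ^ 2 * (w₀ ^ 2 - μs ^ 2) with hκs
  have hκsI : κs ∈ Ioo (-K) 0 := by
    constructor
    · rw [hκs, hK]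
      have h1 : μs ^ 2 - w₀ ^ 2 ≤ 1 := by linarith only [hμs2le, hx₀xt, hxt1]
      have h2 := mul_le_mul_of_nonneg_left h1 ha2.le
      have h3 : 0 ≤ a ^ 2 * |w₀| := by positivity
      linarith only [h2, h3, ha2]
    · rw [hκs]; exact mul_neg_of_pos_of_neg ha2 (by linarith only [hgS])
  obtain ⟨gx, εg, hεg, hgx, hgxr⟩ := exists_local_complex_branch (m := m) hB hκsI
  set Pc : ℝ → ℂ → ℂ × ℂ × ℂ := fun μ z ↦ curveP a m gx μ z with hPc
  have hreal : ∀ μ x : ℝ, |a ^ 2 * (x ^ 2 - μ ^ 2) - κs| < εg →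
      Pc μ (x : ℂ) = ((x : ℂ), ((γ (a ^ 2 * (x ^ 2 - μ ^ 2)) + cm : ℝ) : ℂ), ((μ ^ 2 : ℝ) : ℂ)) ∧
        a ^ 2 * (x ^ 2 - μ ^ 2) ∈ Icc (-K) 0 := by
    intro μ x hx
    obtain ⟨hg, hI⟩ := hgxr _ hx
    exact ⟨curveP_ofReal hg, hI⟩
  have hthr : ∀ μ : ℝ, |a ^ 2 * (w₀ ^ 2 - μ ^ 2) - κs| < εg → Pc μ (w₀ : ℂ) = thrP M a m (Lam μ) ((μ ^ 2 : ℝ)) := by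
    intro μ hμ
    obtain ⟨he, hI⟩ := hreal μ w₀ hμ
    rw [he, hLam, LamOf_eq hI]
    rfl
  have hκs0 : |a ^ 2 * (w₀ ^ 2 - μs ^ 2) - κs| < εg := by rw [hκs, sub_self, abs_zero]; exact hεg
  have hPs : Pc μs (w₀ : ℂ) = thrP M a m (Lam μs) ((μs ^ 2 : ℝ)) := hthr μs hκs0
  ------------------------------------------------------------------
  -- Step 8: the good neighbourhood of `(ω₀, μs)`
  ------------------------------------------------------------------
  have hkap0 : kapOf a (w₀ : ℂ) μs = (κs : ℂ) := by rw [kapOf_ofReal]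
  have hgxs : sphmShoot m₀ (gx (κs : ℂ), (κs : ℂ)) = 0 ∧ ContDiffAt ℂ 1 gx (κs : ℂ) := hgx _ (mem_ball_self hεg)
  have hq₀good : ContinuousAt gx (kapOf a (w₀ : ℂ) μs) := by rw [hkap0]; exact hgxs.2.continuousAt
  have hPcont₀ : ContinuousAt (fun q : ℂ × ℝ ↦ Pc q.2 q.1) ((w₀ : ℂ), μs) := continuousAt_curveP hq₀good
  have hev_good : ∀ᶠ q : ℂ × ℝ in 𝓝 ((w₀ : ℂ), μs),
      kapOf a q.1 q.2 ∈ ball (κs : ℂ) εg ∧ IsAdmS Rb gS (Pc q.2 q.1) ∧ Pc q.2 q.1 ∈ horGood M a := by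
    have e1 : ∀ᶠ q : ℂ × ℝ in 𝓝 ((w₀ : ℂ), μs), kapOf a q.1 q.2 ∈ ball (κs : ℂ) εg :=
      (continuous_kapOf a).continuousAt.preimage_mem_nhds (by rw [hkap0]; exact isOpen_ball.mem_nhds (mem_ball_self hεg))
    have e2 : ∀ᶠ q : ℂ × ℝ in 𝓝 ((w₀ : ℂ), μs), IsAdmS Rb gS (Pc q.2 q.1) :=
      hPcont₀.preimage_mem_nhds ((isOpen_isAdmS Rb gS).mem_nhds (by
        show IsAdmS Rb gS (Pc μs (w₀ : ℂ)); rw [hPs]; exact hps_admS))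
    have e3 : ∀ᶠ q : ℂ × ℝ in 𝓝 ((w₀ : ℂ), μs), Pc q.2 q.1 ∈ horGood M a :=
      hPcont₀.preimage_mem_nhds ((isOpen_horGood M a).mem_nhds (by
        show Pc μs (w₀ : ℂ) ∈ horGood M a; rw [hPs]; exact thrP_mem_horGood h _ _))
    exact e1.and (e2.and e3)
  obtain ⟨ε₀, hε₀, hgood⟩ := Metric.eventually_nhds_iff.1 hev_good
  have hgood' : ∀ (z : ℂ) (μ : ℝ), ‖z - (w₀ : ℂ)‖ < ε₀ → |μ - μs| < ε₀ →
      kapOf a z μ ∈ ball (κs : ℂ) εg ∧ IsAdmS Rb gS (Pc μ z) ∧ Pc μ z ∈ horGood M a := by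
    intro z μ hz hμ
    exact @hgood (z, μ) (by rw [Prod.dist_eq, dist_eq_norm, Real.dist_eq]; exact max_lt hz hμ)
  ------------------------------------------------------------------
  -- Step 9: the Newton hypotheses
  ------------------------------------------------------------------
  set F : ℂ → ℝ → ℂ := fun z μ ↦ matchA M a m h hR₁ hgS (Pc μ z) with hF
  set ρ₁ : ℝ := ε₀ / 2 with hρ₁
  have hρ₁0 : 0 < ρ₁ := by positivity
  have hρ₁ε : ρ₁ < ε₀ := by simp only [hρ₁]; linarith only [hε₀]
  have hIcc : ∀ μ ∈ Icc (μs - ρ₁) (μs + ρ₁), |μ - μs| < ε₀ := fun μ hμ ↦ by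
    rw [abs_lt]; constructor <;> linarith only [hμ.1, hμ.2, hρ₁ε]
  have hball : ∀ z ∈ ball (w₀ : ℂ) ρ₁, ‖z - (w₀ : ℂ)‖ < ε₀ := fun z hz ↦ by
    rw [mem_ball, dist_eq_norm] at hz; exact hz.trans hρ₁ε
  have hhol : ∀ μ ∈ Icc (μs - ρ₁) (μs + ρ₁), DifferentiableOn ℂ (fun z ↦ F z μ) (ball (w₀ : ℂ) ρ₁) := by
    intro μ hμ z hz
    obtain ⟨hk, hadm, hgd⟩ := hgood' z μ (hball z hz) (hIcc μ hμ)
    exact (differentiableAt_matchA_comp h hRb0 hgS hMR (contDiffAt_curveP (hgx _ hk).2) hadm.isAdm hgd).differentiableWithinAt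
  have hcont : ContinuousOn (fun q : ℂ × ℝ ↦ F q.1 q.2) (ball (w₀ : ℂ) ρ₁ ×ˢ Icc (μs - ρ₁) (μs + ρ₁)) := by
    intro q hq
    obtain ⟨hk, hadm, hgd⟩ := hgood' q.1 q.2 (hball q.1 hq.1) (hIcc q.2 hq.2)
    have hc1 : ContinuousAt (fun q : ℂ × ℝ ↦ Pc q.2 q.1) q := continuousAt_curveP (hgx _ hk).2.continuousAt
    exact (ContinuousAt.comp (g := matchA M a m h hR₁ hgS) (f := fun q : ℂ × ℝ ↦ Pc q.2 q.1) (x := q)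
      (continuousAt_matchA h hRb0 hgS hMR hadm.isAdm hgd) hc1).continuousWithinAt
  have hAs0 : matchA M a m h hR₁ hgS (thrP M a m (Lam μs) ((μs ^ 2 : ℝ))) = 0 :=
    matchA_thrP_eq_zero_of_decay h hRb0 hgS hMR hps_admS.isAdm hdecS
  have hF0 : F (w₀ : ℂ) μs = 0 := by
    show matchA M a m h hR₁ hgS (Pc μs (w₀ : ℂ)) = 0
    rw [hPs]; exact hAs0
  -- the derivative `c` and its sign structure
  set c : ℂ := deriv (fun z ↦ F z μs) (w₀ : ℂ) with hc_def
  obtain ⟨us, ρs, ρs₁, hus_def, -, hus, -, hρspos, hreps, -⟩ :=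
    matchA_thrP_eq h hRb0 hgS hMR (Lam μs) ((μs ^ 2 : ℝ)) hps_admS.isAdm
  have hderiv := im_deriv_matchA_threshold h hRb0 hgS hMR (P := Pc μs) (contDiffAt_curveP (by rw [hkap0]; exact hgxs.2))
    (Lr := fun x ↦ γ (a ^ 2 * (x ^ 2 - μs ^ 2)) + cm) (σ := μs ^ 2) (by
      have hc : ContinuousAt (fun x : ℝ ↦ a ^ 2 * (x ^ 2 - μs ^ 2)) w₀ := by fun_prop
      have hev : ∀ᶠ x : ℝ in 𝓝 w₀, |a ^ 2 * (x ^ 2 - μs ^ 2) - κs| < εg := by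
        have := hc.preimage_mem_nhds (Metric.ball_mem_nhds (a ^ 2 * (w₀ ^ 2 - μs ^ 2)) hεg)
        filter_upwards [this] with x hx
        rwa [mem_preimage, mem_ball, Real.dist_eq, ← hκs] at hx
      filter_upwards [hev] with x hx using (hreal μs x hx).1)
    (by rw [hPs]; exact hps_admS) (by rw [hPs]; exact hAs0)
  rw [hPs] at hderiv
  have hrec_ne : recY M a m h hR₁ hgS (thrP M a m (Lam μs) ((μs ^ 2 : ℝ))) (R₁ + 1) ≠ 0 :=
    recY_ne_zero h hRb0 hgS hMR hps_admS.isAdm ht₁m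
  have hnorm : 0 < ‖recY M a m h hR₁ hgS (thrP M a m (Lam μs) ((μs ^ 2 : ℝ))) (R₁ + 1)‖ := norm_pos_iff.2 hrec_ne
  have hcF : c = deriv (fun z ↦ matchA M a m h hR₁ hgS (Pc μs z)) (w₀ : ℂ) := rfl
  obtain ⟨er0, -⟩ := hreps (R₁ + 1) ht₁m
  obtain ⟨fz0, -⟩ := radY_thrP_eq (m := m) h (Lam μs) ((μs ^ 2 : ℝ)) (r := R₁ + 1) ht₁r
  have hzs1 : 0 < thrZ M a m (Lam μs) ((μs ^ 2 : ℝ)) (R₁ + 1) := hposS (R₁ + 1) ht₁r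
  have hρs1 : 0 < ρs (R₁ + 1) := hρspos (R₁ + 1) ht₁m
  have hkey : (c * conj (us * thrPhase0 M a m)).im * (ρs (R₁ + 1) * thrZ M a m (Lam μs) ((μs ^ 2 : ℝ)) (R₁ + 1)) =
      -(2 * M * Kerr.rPlus M a) * ‖recY M a m h hR₁ hgS (thrP M a m (Lam μs) ((μs ^ 2 : ℝ))) (R₁ + 1)‖ ^ 2 := by
    rw [← hderiv, ← hcF, er0, fz0]
    simp only [map_mul, Complex.conj_ofReal, Complex.mul_im, Complex.mul_re, Complex.ofReal_re, Complex.ofReal_im]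
    ring
  have hprod : 0 < ρs (R₁ + 1) * thrZ M a m (Lam μs) ((μs ^ 2 : ℝ)) (R₁ + 1) := mul_pos hρs1 hzs1
  have hRneg : -(2 * M * Kerr.rPlus M a) * ‖recY M a m h hR₁ hgS (thrP M a m (Lam μs) ((μs ^ 2 : ℝ))) (R₁ + 1)‖ ^ 2 < 0 := by
    have h3 : 0 < 2 * M * Kerr.rPlus M a * ‖recY M a m h hR₁ hgS (thrP M a m (Lam μs) ((μs ^ 2 : ℝ))) (R₁ + 1)‖ ^ 2 :=
      mul_pos (mul_pos (mul_pos two_pos hMpos) hrp) (pow_pos hnorm 2)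
    linarith only [h3]
  have hsneg : (c * conj (us * thrPhase0 M a m)).im < 0 := by
    by_contra hge
    push Not at hge
    have := mul_nonneg hge hprod.le
    rw [hkey] at this
    linarith only [this, hRneg]
  set sstar : ℝ := ((us * thrPhase0 M a m) * conj c).im with hsstar
  have hsstar_pos : 0 < sstar := by
    have : (us * thrPhase0 M a m) * conj c = conj (c * conj (us * thrPhase0 M a m)) := by
      rw [map_mul, Complex.conj_conj, mul_comm]
    rw [hsstar, this, Complex.conj_im]; linarith only [hsneg]
  have hcne : c ≠ 0 := by
    intro h0
    have : sstar = 0 := by rw [hsstar, h0, map_zero, mul_zero, Complex.zero_im]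
    linarith only [this, hsstar_pos]
  have hcn : 0 < ‖c‖ := norm_pos_iff.2 hcne
  ------------------------------------------------------------------
  -- Step 10: the perturbed zero
  ------------------------------------------------------------------
  set θ : ℝ := min 1 (sstar / (2 * ‖c‖)) with hθ
  have hθ0 : 0 < θ := lt_min one_pos (by positivity)
  have hθ1 : θ ≤ 1 := min_le_left _ _
  have hθs : θ * ‖c‖ ≤ sstar / 2 :=
    calc θ * ‖c‖ ≤ sstar / (2 * ‖c‖) * ‖c‖ := mul_le_mul_of_nonneg_right (min_le_right _ _) hcn.le
      _ = sstar / 2 := by field_simp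
  have hρN : 0 < min (|w₀| / 2) (ε₀ / 2) := lt_min (by positivity) (by positivity)
  obtain ⟨ρ', hρ', δN, hδN, hNewton⟩ := exists_zero_near_simple_zero hρ₁0 hρ₁0 hhol hcont hF0
    (by rw [← hc_def]; exact hcne) hθ0 hθ1 hρN
  ------------------------------------------------------------------
  -- Step 11: choose `μ < μs` close to `μs`
  ------------------------------------------------------------------
  have hPμc : ContinuousAt (fun μ : ℝ ↦ thrP M a m (Lam μ) ((μ ^ 2 : ℝ) : ℂ)) μs := (continuous_thrP_family hLamc).continuousAt
  have hyc : ContinuousAt (fun μ : ℝ ↦ recY M a m h hR₁ hgS (thrP M a m (Lam μ) ((μ ^ 2 : ℝ))) (R₁ + 1)) μs :=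
    ContinuousAt.comp (g := fun p ↦ recY M a m h hR₁ hgS p (R₁ + 1)) (f := fun μ : ℝ ↦ thrP M a m (Lam μ) ((μ ^ 2 : ℝ)))
      (x := μs) (continuousAt_recY h hRb0 hgS hMR hps_admS.isAdm (R₁ + 1)).1 hPμc
  set uOf : ℝ → ℂ := fun μ ↦ recY M a m h hR₁ hgS (thrP M a m (Lam μ) ((μ ^ 2 : ℝ))) (R₁ + 1) /
    (‖recY M a m h hR₁ hgS (thrP M a m (Lam μ) ((μ ^ 2 : ℝ))) (R₁ + 1)‖ : ℂ) with huOf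
  have huc : ContinuousAt uOf μs :=
    hyc.div (Complex.continuous_ofReal.continuousAt.comp hyc.norm) (by exact_mod_cast hnorm.ne')
  have hus_eq : uOf μs = us := by rw [hus_def]
  have hsc : ContinuousAt (fun μ ↦ ((uOf μ * thrPhase0 M a m) * conj c).im) μs :=
    Complex.continuous_im.continuousAt.comp ((huc.mul continuousAt_const).mul continuousAt_const)
  have hs0 : sstar / 2 < ((uOf μs * thrPhase0 M a m) * conj c).im := by
    rw [hus_eq, ← hsstar]; linarith only [hsstar_pos]
  have hev_s : ∀ᶠ μ in 𝓝 μs, sstar / 2 < ((uOf μ * thrPhase0 M a m) * conj c).im := hsc.eventually (lt_mem_nhds hs0)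
  have hev_esc := eventually_thrZ_pos_on_Ioc (m := m) h hLamc (μa := μa) (μb := μb) hμapos.le hposS (R₁ + 1)
  have hev_close : ∀ᶠ μ in 𝓝 μs, |μ - μs| < min δN ρ₁ ∧ |a ^ 2 * (w₀ ^ 2 - μ ^ 2) - κs| < εg := by
    have e1 : ∀ᶠ μ in 𝓝 μs, |μ - μs| < min δN ρ₁ := by
      have := Metric.ball_mem_nhds μs (lt_min hδN hρ₁0)
      filter_upwards [this] with μ hμ
      rwa [mem_ball, Real.dist_eq] at hμ
    have e2 : ∀ᶠ μ in 𝓝 μs, |a ^ 2 * (w₀ ^ 2 - μ ^ 2) - κs| < εg := by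
      have hc : ContinuousAt (fun μ : ℝ ↦ a ^ 2 * (w₀ ^ 2 - μ ^ 2)) μs := by fun_prop
      have := hc.preimage_mem_nhds (Metric.ball_mem_nhds (a ^ 2 * (w₀ ^ 2 - μs ^ 2)) hεg)
      filter_upwards [this] with μ hμ
      rwa [mem_preimage, mem_ball, Real.dist_eq, ← hκs] at hμ
    exact e1.and e2
  obtain ⟨εμ, hεμ, hεμ'⟩ := Metric.eventually_nhds_iff.1 (hev_s.and (hev_esc.and hev_close))
  set μ : ℝ := max μa (μs - εμ / 2) with hμ_def
  have hμlt : μ < μs := max_lt hμsa (by linarith only [hεμ])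
  have hμa_le : μa ≤ μ := le_max_left _ _
  have hμpos : 0 < μ := hμapos.trans_le hμa_le
  have hμdist : dist μ μs < εμ := by
    rw [Real.dist_eq, abs_sub_comm, abs_of_pos (sub_pos.2 hμlt)]
    linarith only [le_max_right μa (μs - εμ / 2), hεμ]
  obtain ⟨hsμ, hescμ, hcloseμ, hκμ⟩ := hεμ' hμdist
  have hμI : μ ∈ Icc μa μb := ⟨hμa_le, hμlt.le.trans hμsI.2⟩
  have hzpos : ∀ t ∈ Ioc (Kerr.rPlus M a) (R₁ + 1), 0 < thrZ M a m (Lam μ) ((μ ^ 2 : ℝ)) t := hescμ hμI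
  have hμδN : |μ - μs| < δN := lt_of_lt_of_le hcloseμ (min_le_left _ _)
  have hμρ₁ : |μ - μs| < ρ₁ := lt_of_lt_of_le hcloseμ (min_le_right _ _)
  have hμε₀ : |μ - μs| < ε₀ := hμρ₁.trans hρ₁ε
  obtain ⟨-, hadmμ, -⟩ := hgood' (w₀ : ℂ) μ (by rw [sub_self, norm_zero]; exact hε₀) hμε₀
  have hPμ : Pc μ (w₀ : ℂ) = thrP M a m (Lam μ) ((μ ^ 2 : ℝ)) := hthr μ hκμ
  rw [hPμ] at hadmμ
  ------------------------------------------------------------------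
  -- Step 12: the sign of `W_μ`
  ------------------------------------------------------------------
  obtain ⟨uμ, ρμ, ρμ₁, huμ_def, -, huμ, hρμsol, hρμpos, -, hAμ⟩ :=
    matchA_thrP_eq h hRb0 hgS hMR (Lam μ) ((μ ^ 2 : ℝ)) hadmμ.isAdm
  have huμ_eq : uμ = uOf μ := by rw [huμ_def]
  have hzero_μ : ∃ t ∈ Ioi (Kerr.rPlus M a), thrZ M a m (Lam μ) ((μ ^ 2 : ℝ)) t = 0 :=
    exists_zero_of_lt (m := m) h (LamOf_mono hK0 hγanti hμpos.le hμlt.le)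
      (pow_lt_pow_left₀ hμlt hμpos.le two_ne_zero) (by
        have : |w₀| ^ 2 < μ ^ 2 := pow_lt_pow_left₀ (hw₀μa.trans_le hμa_le) (abs_nonneg _) two_ne_zero
        rwa [sq_abs] at this) hposS hdecS
  set Wμ : ℝ := wronskian ρμ ρμ₁ (thrZ M a m (Lam μ) ((μ ^ 2 : ℝ))) (thrZ₁ M a m (Lam μ) ((μ ^ 2 : ℝ))) (R₁ + 1) with hWμ_def
  have hWμ : Wμ < 0 := wronskian_thr_neg h hR₁ hρμsol hρμpos hzpos hzero_μ
  have hW : 0 < -Wμ := by linarith only [hWμ]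
  ------------------------------------------------------------------
  -- Step 13: Newton, and `Im ω > 0`
  ------------------------------------------------------------------
  obtain ⟨zN, hzN, hFz, hest⟩ := hNewton μ hμδN
  set U : ℂ := uμ * thrPhase0 M a m with hU
  have hUn : ‖U‖ = 1 := by rw [hU, norm_mul, huμ, norm_thrPhase0, one_mul]
  have hsμ' : sstar / 2 < (U * conj c).im := by rw [hU, huμ_eq]; exact hsμ
  have hFμ : F (w₀ : ℂ) μ = U * (Wμ : ℂ) := by
    show matchA M a m h hR₁ hgS (Pc μ (w₀ : ℂ)) = _
    rw [hPμ, hAμ, hU]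
  have hc_def' : deriv (fun z ↦ F z μs) (w₀ : ℂ) = c := rfl
  rw [hc_def', hFμ] at hest
  -- the target point of the Newton step
  have hv : (w₀ : ℂ) - U * (Wμ : ℂ) / c = (w₀ : ℂ) + ((-Wμ : ℝ) : ℂ) * (U / c) := by
    push_cast; field_simp; ring
  have hvnorm : ‖U * (Wμ : ℂ) / c‖ = (-Wμ) / ‖c‖ := by
    rw [norm_div, norm_mul, hUn, one_mul, Complex.norm_real, Real.norm_eq_abs, abs_of_neg hWμ]
  rw [hv, hvnorm] at hest
  have him_div : (U / c).im = (U * conj c).im / ‖c‖ ^ 2 := im_div_eq_im_mul_conj U c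
  have hzN_im : 0 < zN.im := by
    have h1 : |zN.im - ((w₀ : ℂ) + ((-Wμ : ℝ) : ℂ) * (U / c)).im| ≤ θ * ((-Wμ) / ‖c‖) := by
      have := Complex.abs_im_le_norm (zN - ((w₀ : ℂ) + ((-Wμ : ℝ) : ℂ) * (U / c)))
      rw [Complex.sub_im] at this
      exact this.trans hest
    have h2 : ((w₀ : ℂ) + ((-Wμ : ℝ) : ℂ) * (U / c)).im = (-Wμ) * ((U * conj c).im / ‖c‖ ^ 2) := by
      rw [Complex.add_im, Complex.ofReal_im, zero_add, Complex.im_ofReal_mul, him_div]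
    rw [h2] at h1
    have h3 := (abs_le.1 h1).1
    have h4 : θ * ((-Wμ) / ‖c‖) < (-Wμ) * ((U * conj c).im / ‖c‖ ^ 2) := by
      have e : θ * ((-Wμ) / ‖c‖) = (-Wμ) * (θ * ‖c‖ / ‖c‖ ^ 2) := by
        rw [pow_two, mul_div_mul_right _ _ hcn.ne']; ring
      rw [e]
      refine mul_lt_mul_of_pos_left ?_ hW
      exact div_lt_div_of_pos_right (by linarith only [hθs, hsμ']) (pow_pos hcn 2)
    linarith only [h3, h4]
  have hzN_norm : ‖zN - (w₀ : ℂ)‖ ≤ ρ' := by rw [← dist_eq_norm]; exact mem_closedBall.1 hzN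
  have hzN_re : zN.re ≠ 0 := by
    have h1 : ‖zN - (w₀ : ℂ)‖ ≤ |w₀| / 2 := hzN_norm.trans (hρ'.2.trans (min_le_left _ _))
    have h2 : |zN.re - w₀| ≤ |w₀| / 2 := by
      have := Complex.abs_re_le_norm (zN - (w₀ : ℂ))
      rw [Complex.sub_re, Complex.ofReal_re] at this
      exact this.trans h1
    intro h0
    rw [h0, zero_sub, abs_neg] at h2
    linarith only [h2, hw₀abs]
  ------------------------------------------------------------------
  -- Step 14: the data
  ------------------------------------------------------------------
  have hzN_ball : ‖zN - (w₀ : ℂ)‖ < ε₀ :=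
    lt_of_le_of_lt (hzN_norm.trans (hρ'.2.trans (min_le_right _ _))) (by linarith only [hε₀])
  obtain ⟨hkN, hadmN, -⟩ := hgood' zN μ hzN_ball hμε₀
  have hνN : sphmShoot m.natAbs (gx (kapOf a zN μ), kapOf a zN μ) = 0 := (hgx _ hkN).1
  have hPN : Pc μ zN = (zN, gx (kapOf a zN μ) + (m.natAbs : ℂ) * ((m.natAbs : ℂ) + 1), ((μ ^ 2 : ℝ) : ℂ)) := rfl
  obtain ⟨Λ, Sa, Y, hSa, hY, hSne, Rf, f, hRf, hf, hRform, hRne, hdecR⟩ :=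
    separated_data_of_zero h hm hRb0 hgS hMR hzN_im.le hνN (by rw [← hPN]; exact hadmN.isAdm) (by rw [← hPN]; exact hFz)
  -- smallness `a²‖ω‖² ≤ m₀(m₀+1)` for the angular input (`‖ω − ω₀‖ ≤ |ω₀|/2`)
  have hsmall : a ^ 2 * ‖zN‖ ^ 2 ≤ (m₀ : ℝ) * ((m₀ : ℝ) + 1) :=
    sq_norm_le_of_near_omega0 (m := m) h (hzN_norm.trans (hρ'.2.trans (min_le_left _ _)))
  have hsr : 2 * M * Kerr.rPlus M a * ‖zN‖ < |a * m| :=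
    superradiant_mdR_of_zero h hm hRb0 hgS hMR hzN_im hνN hsmall (by rw [← hPN]; exact hadmN.isAdm)
      (by rw [← hPN]; exact hFz)
  refine ⟨μ, hμpos, ?_, zN, hzN_im, hzN_re, hsr, Λ, Sa, Y, hSa, hY, hSne, Rf, f, hRf, hf, hRform, hRne, hdecR⟩
  rw [← abs_omega0 h]
  have hlow : |w₀| < μ := hw₀μa.trans_le hμa_le
  rw [abs_lt]; constructor <;> linarith only [hlow, hμlt, hμsδ]

/-- **Unstable mode data** (the statement of `exists_superradiant_mode_data` without the
superradiance clause; kept under its original name). [cite: ShlapentokhRothman2014KleinGordon, Thm. 1.2] -/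
theorem exists_mode_data (h : Kerr.IsSubextremal M a) (ha : a ≠ 0) (hm : m ≠ 0) {δ : ℝ} (hδ : 0 < δ) :
    ∃ μ > (0 : ℝ), |μ - |a * m| / (2 * M * Kerr.rPlus M a)| < δ ∧
      ∃ w : ℂ, 0 < w.im ∧ w.re ≠ 0 ∧
      ∃ (Λ : ℂ) (S : ℝ → ℂ) (Y : E3 → ℂ),
        IsAngularSolution a w μ m Λ S ∧ IsSphericalExtension m S Y ∧ (∃ θ ∈ Ioo 0 Real.pi, S θ ≠ 0) ∧
        ∃ R f : ℝ → ℂ, IsRadialSolution M a w m Λ μ R ∧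
          (∃ η > (0 : ℝ), ContDiffOn ℝ ∞ f (Ioi (Kerr.rPlus M a - η))) ∧
          (∀ r ∈ Ioi (Kerr.rPlus M a),
            R r = Complex.exp (-(Complex.I * (w * ((Kerr.starTime M a r : ℝ) : ℂ) -
              (m : ℂ) * ((Kerr.starAngle M a r : ℝ) : ℂ)))) * f r) ∧
          (∃ r ∈ Ioi (Kerr.rPlus M a), R r ≠ 0) ∧
          ∃ C κ : ℝ, 0 < κ ∧ ∀ r : ℝ, Kerr.rPlus M a + 1 ≤ r →
            ‖R r‖ ≤ C * Real.exp (-(κ * r)) ∧ ‖deriv R r‖ ≤ C * Real.exp (-(κ * r)) := by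
  obtain ⟨μ, hμ, hμδ, w, hwim, hwre, -, hrest⟩ := exists_superradiant_mode_data h ha hm hδ
  exact ⟨μ, hμ, hμδ, w, hwim, hwre, hrest⟩

/-- **`KleinGordonSuperradiantInstability` holds** (Shlapentokh-Rothman's Theorem 1.1): the
mode data of `exists_mode_data` fed through the separation/energy glue
`KleinGordonSuperradiantInstability.of_separated_data`. [cite: ShlapentokhRothman2014KleinGordon, Thm. 1.1] -/
theorem KleinGordonSuperradiantInstability_holds : KleinGordonSuperradiantInstability :=
  KleinGordonSuperradiantInstability.of_separated_data fun _ _ hMa ha _ hm _ hδ ↦ exists_mode_data hMa ha hm hδ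

/-- **`ShlapentokhRothman2014_separatedMode` holds** (Shlapentokh-Rothman's Theorem 1.2 in the
printed separated variables, read at one small `ε > 0`, superradiance clause included): the data of
`exists_superradiant_mode_data`. [cite: ShlapentokhRothman2014KleinGordon, Thm. 1.2 with §2 (2.1)–(2.5), Prop. 4.6; mass clause Thm. 1.1] -/
theorem ShlapentokhRothman2014_separatedMode_holds : ShlapentokhRothman2014_separatedMode :=
  fun _ _ hMa ha _ hm _ hδ ↦ exists_superradiant_mode_data hMa ha hm hδ

/-- **`ShlapentokhRothman2014_unstableModeProfile` holds** (Theorem 1.2 in Kerr–Schild-leaf profile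
form): the separated mode through the proved reduction `…unstableModeProfile.of_separatedMode`
(Carter separation on the leaf, `CarterSeparationKSLeaf_holds`). [cite: ShlapentokhRothman2014KleinGordon, Thm. 1.2] -/
theorem ShlapentokhRothman2014_unstableModeProfile_holds : ShlapentokhRothman2014_unstableModeProfile :=
  ShlapentokhRothman2014_unstableModeProfile.of_separatedMode ShlapentokhRothman2014_separatedMode_holds

end Final

end Literature.Barriers.FinalStateConjecture
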